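import Literature.AlgebraicGeometry.Resolution.CentreBlowupThm36Omega
import Literature.AlgebraicGeometry.Resolution.CentreBlowupProp33
import HarnessLib

/-!
# [CP19] Theorem 3.6, the equality clause: "if equality holds in (3.6.4), then `s' ∈ PC(x,𝒴)`" —
  `ω` DROPS off the cone `C(x,𝒴)` of Def. 3.3 (`Max(x)` at a centre of the first kind, §1–§7;
  `Max(J̄(F_{p,Z,W},E,W))` at a centre of the second kind, §8) under the blow-up of a permissible
  coordinate centre, in the model; the atlas predicate `StallOnConeAt` is a theorem at every `p`-fold point

Topic: `Literature/AlgebraicGeometry/Resolution`.  Cell `pub-rosobs` (resolution observatory), unit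
`pub-rosobs-carver-g27`.  Companion of `CentreBlowupThm36Omega.lean` (`ω(x') ≤ ω(x)` at first-kind
centres, unit g26), `CentreBlowupThm36FirstKind.lean` / `…SecondKind.lean` / `…Permissible.lean` (the
`ε`-clauses of Thm. 3.6 (1)), and of the typing files `PointBlowupAdaptedOrder.lean` (the predicates
`InMax`, `coneGens`, `OnAdaptedCone`, `direction`, `StallOnConeAt`) and `CentreBlowupAdaptedOrder.lean`.

* V. Cossart, O. Piltant, *Resolution of singularities of arithmetical threefolds*, J. Algebra **529**
  (2019) 268–535, arXiv:1412.0868 — ch. 3 "Permissible blowing ups", Theorem 3.6 (PDF p. 35):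
  "… Then `(m(x'), ω(x'), κ(x')) ≤ (m(x), ω(x), κ(x))`.  If equality holds in (3.6.4), then
  `s' ∈ PC(x,𝒴)`", with Definition 3.3 (PDF p. 33): "Let `𝒴 ⊂ 𝒳` be a permissible center at `x`. We
  denote by `C(x,𝒴)` the cone: `C(x,𝒴) := Spec(k(x)[{U_j}_{j∈J}]/(IMax(x) ∩ k(x)[{U_j}_{j∈J}]))` if `𝒴`
  is of the first kind", Definition 2.17 (PDF p. 24): "`Max(x) := Max(V(TF_{p,Z},E,m_S)) ∩ {U_B = 0}` if
  `ω(x) = ε(x) − 1`, `Max(J(TF_{p,Z},E,m_S)) ∩ {U_B = 0}` if `ω(x) = ε(x)`", Definition 2.13 (PDF p. 20):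
  "`Max(I) := {x ∈ 𝐕 : ord_x F_i = d, 1 ≤ i ≤ m}`", and the proof of Thm. 3.6, Case 1 (first kind,
  PDF p. 36): "`IMax(x) = (J(F_{p,Z},E,m_S))G(m_S)` [resp. `(V(F_{p,Z},E,m_S))G(m_S)`] … We deduce that
  `ord̄ I' ≤ ω(x)` and `s' ∉ PC(x,𝒴) ⟹ ord̄ I' < ω(x)` (3.6.9.1) … `ω(x') ≤ ω(x)` and this inequality is
  strict under the assumption of (3.6.9.1)"; for the second kind Definition 3.3 (PDF p. 33): "`C(x,𝒴) :=
  Max(J̄(F_{p,Z,W},E,W)) ∩ {U_{B_J}=0}`", the proof of Proposition 3.3 (PDF p. 32): "`J̄(F_{p,Z,W},E,W) =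
  <H⁻¹∂F_{p,Z}/∂U_{j'} : j' ∈ J'∖(J')_E> ⊆ k(x)[{U_j}_{j∈J}]_{ε(y)}`" and the proof of Thm. 3.6, Case 3
  (PDF p. 39): "`ord̄ J(F_{p,Z',W'},E_{W'},W') ≤ ω(x)` and equality holds only if `s' ∈ PC(x,𝒴)` …
  This is a contradiction with the assumption `ε(x') = ω(x')`. Thus it can be assumed that `s' ∈ PC(x,𝒴)`"
  (quoted at length in §8).

## Dictionary (the cell's coordinate-centre model `CentreBlowup.CState / step`, `E = exc`, `G = 0`)

* a form `G` and a vector `v`: "`v ∈ Max(G)`", i.e. `ord_v G = deg G` (Def. 2.13) ⟺ `G(U + v) = G(U)`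
  ⟺ `PointBlowup.InMax G v` (`translate v G = G`);
* the cone ideal: `J(F_{p,Z},E) = H⁻¹⟨U_l ∂F_{p,Z}/∂U_l : l ∈ E⟩` when `ω = ε` (`V = 0`), resp.
  `V(F_{p,Z},E) = H⁻¹⟨∂F_{p,Z}/∂U_l : l ∉ E⟩` when `ω = ε − 1` (`V ≠ 0`) ⟷ `PointBlowup.coneGens E F`
  (`F_{p,Z} = initialForm F`, `H = y^{H|_E}`, `T = id` and `U_B = ∅` since `G = 0`); "`v ∈ Max(x)`" ⟷
  `PointBlowup.OnAdaptedCone E s v` (every generator is `v`-invariant);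
* the point `s' ∈ σ⁻¹(m_S) = Proj k(x)[{U_j}_{j∈J}]` reached at the point `b` of the chart `y_j` of the
  blow-up of `C_S` (`j ∈ S = J`, `b_j = 0`, `b = 0` off `S`): the class of `v = e_j + Σ_{i≠j} b_i e_i`
  = `PointBlowup.direction j b`; at a first-kind centre `H⁻¹F_{p,Z} ∈ k(x)[{U_j}_{j∈J}]` (Prop. 3.1,
  tree `CentreBlowupProp31`), so "`s' ∈ PC(x,𝒴)`" (Def. 3.3, first kind) ⟷
  `OnAdaptedCone s.exc s.toState (direction j b)`;
* at a centre of the SECOND kind (`IsSecondKindH p S s`: `p ≤ ord_{C_S}F`, `ε(y) + 1 = ε(x)`, (3.3.1);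
  trees `CentreBlowupTransverseH`, `CentreBlowupProp33`) the cone `C(x,𝒴) = Max(J̄) ∩ {U_{B_J} = 0}`
  (`B = ∅`), `J̄ = <H⁻¹∂F_{p,Z}/∂U_l : l ∉ S, l ∉ exc>` ⟷ `OnSecondKindCone S s v` (every such generator
  is `v`-invariant), read at `v = direction j b`;
* "equality holds in (3.6.4)" at a point where `m(x') = m(x) = p`: `ω(x') = ω(x)` ⟷ `OmegaStalls p S j b s`
  (`κ ∈ {1, ≥ 2}` is `≥ 2` on both sides since `i₀ = p`, and is not modelled).

## What is proved

For a state `s = (F, r, exc)`, a centre `C_S` permissible of the first kind (`IsFirstKind p S s`: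
`p ≤ ord_{C_S} F` and `ε(y) = ε(x)`), a chart `j ∈ S` and a point `b` of the fibre over `x` (`b_j = 0`,
`b = 0` off `S`):

* `CState.omega_step_lt_of_not_onAdaptedCone` — **if `direction j b ∉ Max(x)` then `ω(x') < ω(x)`**
  (no cleanliness, no equimultiplicity, no `ω(x) > 0` needed);
* `CState.onAdaptedCone_of_omegaStalls_of_isFirstKind` — **`ω(x') = ω(x) ⟹ s' ∈ PC(x,𝒴)`**;
* `StallOnConeAtCentre` (the test predicate of the census tables T36b-cc, DEFINED here: the equality
  clause read at one `C_S`-step of the first kind) and `CState.stallOnConeAtCentre` — it holds for every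
  `S, j, b, s`;
* `omegaStalls_univ_iff` and `CState.stallOnConeAt_point` — **the point atlas's row-wise test predicate
  `PointBlowup.StallOnConeAt p j b E s` (`PointBlowupAdaptedOrder.lean`) holds at every `p`-fold point**
  (`p ≤ ord₀ F`: the point is a first-kind centre, `isFirstKind_univ`), for every boundary `E` and every
  point `b` of the exceptional divisor of the chart (`b_j = 0`); its hypotheses `IsEquimultiplePoint`,
  `0 < ω(x) < ⊤` are not used.

And for a centre `C_S` permissible of the second kind (`IsSecondKindH p S s`, implied by the atlas's
undivided reading `IsSecondKind p S s`), same `j, b` (§8):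

* `OnSecondKindCone` (DEFINED here: "`v ∈ C(x,𝒴)`", Def. 3.3 second kind) and
  `onSecondKindCone_of_onAdaptedCone` (`Max(x) ⊆ C(x,𝒴)` where `V ≠ 0`);
* `CState.omega_step_lt_of_not_onSecondKindCone` — **if `direction j b ∉ C(x,𝒴)` then `ω(x') < ω(x)`**;
* `CState.onSecondKindCone_of_omegaStalls_of_isSecondKindH` / `…_of_isSecondKind` —
  **`ω(x') = ω(x) ⟹ s' ∈ PC(x,𝒴)`**, and `CState.onCone_of_omegaStalls_of_isPermissibleCentre` (either kind);
* `StallOnSecondKindConeAtCentre` (test predicate, DEFINED here) and `CState.stallOnSecondKindConeAtCentre`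
  — it holds for every `S, j, b, s`.

Census support (observatory `PATTERNS.md`, tables T36b / T36b-cc): 6 043 + 1 706 + 6 055 + 5 440 stalls
of `ω` at equimultiple points of point blow-ups, 0 off the cone; 17 896 + 714 stalls at first-kind
coordinate centres, 0 off the cone; at NON-first-kind `bm` centres 51 of 164 stalls are off the
(first-kind) cone `Max(x)` — the second-kind cone of Def. 3.3 (`Max(J̄(F_{p,Z,W},E,W)) ∩ {U_{B_J} = 0}`)
is a BIGGER object (fewer generators), typed in §8; exhaustive model enumeration (unit g27, packet
`pub-rosobs-carver-g27/code/cone2_search.py`, 7 parameter boxes, 96 214 second-kind (`IsSecondKindH`)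
chart points): 64 601 points off `C(x,𝒴)`, all with `ω(x') < ω(x)`; 26 795 stalls, all on `C(x,𝒴)`,
1 014 of them off `Max(x)`.

Mechanism (the model form of CP's (3.6.9.1), PDF p. 36, on top of the transport of the Jacobian module of
`CentreBlowupThm36Omega.lean`, whose private helpers are duplicated in §0 below so that this file is
self-contained): let `g` be a cone generator that is not `v`-invariant, `g` homogeneous of degree `ω(x)`.
(i) DEHOMOGENISATION (`§1`): `v ∈ Max(g)` iff every monomial of `g(U + b)|_{U_j = 1}` has degree
`≥ ω(x)` — proved by conjugating with Hauser's shear `U_i ↦ U_i + b_i U_j`, which maps forms to forms,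
turns `translate v` into `translate e_j` and `(·)|_{U_j=1} ∘` itself into `translate b ∘ (·)|_{U_j=1}`, and
by the remark that a form of degree `ω` all of whose monomials have `U_j`-free part of degree `≥ ω` does not
involve `U_j`; so `g(U + b)|_{U_j=1}` has a monomial `y^β` with `|β| < ω(x)`.  (ii) THE LOW MONOMIAL
(`§2–3`): the image under the termwise chart map `T` of the initial part of `U_l ∂F/∂U_l` factors EXACTLY
as `y^{ρ} · (H⁻¹U_l∂F_{p,Z}/∂U_l)|_{U_j=1}` (`ρ = H|_E` with `ρ_j = ord_{C_S}F − p`), hence its translate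
is `(y + b)^ρ · W` with `W = translate_b((H⁻¹U_l∂F_{p,Z}/∂U_l)|_{U_j=1})`, and the UNIT LEMMA
`coeff_{ρ_Z + β}((y + b)^ρ · W) = (unit) · coeff_β W` for `β` of least degree in `W` (`ρ_Z = ρ|_{b=0} = r'`,
the new record) exhibits a monomial of degree `|r'| + |β| ≤ |r'| + ω(x) − 1` which the non-initial part
cannot cancel (separation by (`y_j`-exponent, `Σ_{u∉S}`-degree), as in g26).  (iii) READING (`§4`, g26):
that monomial is read off `U_j∂G/∂U_j` (Euler transport), `(U_l + b_l)∂G/∂U_l` or — for `b_l = 0`,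
`l ∉ E'` — as a `V`-witness of `F'` one degree higher, giving `ω(x') ≤ ω(x) − 1`.

## Scope (what this is NOT)

Statements about the cell's combinatorial model only: fixed coordinates (no re-choice of well adapted
coordinates after the step), `G = 0` (`i₀ = p`, so `κ` carries no information), a perfect-field reading
of `V`, of `Max` and of the cleaning, centres of the first kind (§1–§7) and of the second kind in the
Hironaka-permissible `H`-divided reading `IsSecondKindH` (§8), points `b` of the chart with `b = 0`
off `S`.  The citation tags name the printed statements these model theorems read; they do not claim a
formalisation of [CP19]'s theorem for arithmetical threefolds.  AI-assisted formalisation (observatory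
`pub-rosobs`).
-/

noncomputable section

open MvPolynomial Finset

open scoped BigOperators

namespace Literature.AlgebraicGeometry.Resolution

open Literature.AlgebraicGeometry.Resolution.Hauser2010
open Literature.AlgebraicGeometry.Resolution.HauserPerlega2019 (initialForm)
open Literature.Barriers.ResolutionOfSingularities

namespace CentreBlowup

/-! ### 0. Helpers (duplicated from `CentreBlowupThm36Omega.lean`, where they are private) -/

section Helpers

variable {σ : Type*} {K : Type*} [Field K]

/-- evaluation of `bigHVec`. [folklore] -/
private theorem bigHVec_apply' [DecidableEq σ] (E : Finset σ) (F : MvPolynomial σ K) (i : σ) :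
    PointBlowup.bigHVec E F i = if i ∈ E then (PointBlowup.bigH F i).toNat else 0 := by
  unfold PointBlowup.bigHVec
  rw [Finsupp.finsetSum_apply]
  by_cases hi : i ∈ E
  · rw [if_pos hi, Finset.sum_eq_single_of_mem i hi (fun j _ hji => by
      rw [Finsupp.single_apply, if_neg hji])]
    exact Finsupp.single_eq_same
  · rw [if_neg hi]
    exact Finset.sum_eq_zero fun j hj => by
      have hji : j ≠ i := fun h => hi (h ▸ hj)
      rw [Finsupp.single_apply, if_neg hji]

/-- `H_i ≤ d_i` for every monomial `y^d` of `F`. [folklore] -/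
private theorem bigH_le' {F : MvPolynomial σ K} {d : σ →₀ ℕ} (hd : d ∈ F.support) (i : σ) :
    PointBlowup.bigH F i ≤ d i :=
  Finset.inf_le (f := fun d : σ →₀ ℕ => ((d i : ℕ) : ℕ∞)) hd

/-- For `F ≠ 0`, `H_i` is finite. [folklore] -/
private theorem bigH_eq_toNat' {F : MvPolynomial σ K} (hF : F ≠ 0) (i : σ) :
    PointBlowup.bigH F i = (((PointBlowup.bigH F i).toNat : ℕ) : ℕ∞) := by
  obtain ⟨d, -, h⟩ := Finset.exists_mem_eq_inf F.support (MvPolynomial.support_nonempty.mpr hF)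
    (fun d : σ →₀ ℕ => ((d i : ℕ) : ℕ∞))
  rw [show PointBlowup.bigH F i = ((d i : ℕ) : ℕ∞) from h]
  rfl

/-- For `F ≠ 0`, `ord₀ F` is finite. [folklore] -/
private theorem exists_ordZero_eq' {F : MvPolynomial σ K} (hF : F ≠ 0) : ∃ o : ℕ, ordZero F = o := by
  have hne : ordZero F ≠ ⊤ := by
    unfold ordZero
    rw [Ne, MvPowerSeries.order_eq_top_iff, MvPolynomial.coe_eq_zero_iff]
    exact hF
  exact ⟨(ordZero F).toNat, (ENat.coe_toNat hne).symm⟩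

/-- A finite order means a non-zero polynomial. [folklore] -/
private theorem ne_zero_of_ordZero_eq' {F : MvPolynomial σ K} {o : ℕ} (ho : ordZero F = o) : F ≠ 0 := by
  intro h
  rw [h, ordZero_zero] at ho
  exact ENat.top_ne_coe _ ho

/-- `y^{H|_E} ∣ F` monomialwise. [folklore] -/
private theorem bigHVec_le' [DecidableEq σ] (E : Finset σ) (F : MvPolynomial σ K) :
    ∀ d ∈ F.support, PointBlowup.bigHVec E F ≤ d := by
  intro d hd
  have hF : F ≠ 0 := MvPolynomial.ne_zero_iff.mpr ⟨d, MvPolynomial.mem_support_iff.mp hd⟩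
  rw [Finsupp.le_def]
  intro i
  rw [bigHVec_apply']
  split_ifs with hi
  · have h := bigH_le' hd i
    rw [bigH_eq_toNat' hF] at h
    exact_mod_cast h
  · exact Nat.zero_le _

/-- `Σ_{i ∈ E} H_i = |H|_E|` for `F ≠ 0`. [folklore] -/
private theorem sum_bigH_eq' [DecidableEq σ] {F : MvPolynomial σ K} (hF : F ≠ 0) (E : Finset σ) :
    ∑ j ∈ E, PointBlowup.bigH F j = (((PointBlowup.bigHVec E F).degree : ℕ) : ℕ∞) := by
  unfold PointBlowup.bigHVec
  rw [map_sum, Nat.cast_sum]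
  exact Finset.sum_congr rfl fun j _ => by
    rw [Finsupp.degree_single]
    exact bigH_eq_toNat' hF j

/-- `ε(x) = ord₀ F − |H|_exc|` in `ℕ` for `F ≠ 0` of order `o`. [folklore] -/
private theorem epsilon_eq_natCast' [DecidableEq σ] (s : CState σ K) {o : ℕ} (ho : ordZero s.F = o) :
    s.epsilon = ((o - (PointBlowup.bigHVec s.exc s.F).degree : ℕ) : ℕ∞) := by
  rw [CState.epsilon_eq, sum_bigH_eq' (ne_zero_of_ordZero_eq' ho), ho, ← ENat.coe_sub]

/-- `y_i ∂_i (c y^e) = e_i c y^e`. [folklore] -/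
private theorem X_mul_pderiv_monomial' (i : σ) (e : σ →₀ ℕ) (c : K) :
    X i * pderiv i (monomial e c) = monomial e (((e i : ℕ) : K) * c) := by
  rw [X_mul_pderiv_monomial, ← Nat.cast_smul_eq_nsmul K, smul_monomial, smul_eq_mul]

/-- The centre chart exponent off the chart variable. [folklore] -/
private theorem chartExponent_apply_of_ne' [DecidableEq σ] (q : ℕ) (S : Finset σ) {j i : σ}
    (hij : i ≠ j) (d : σ →₀ ℕ) : chartExponent q S j d i = d i := by
  unfold chartExponent
  rw [Finsupp.update_apply, if_neg hij]

/-- The centre chart exponent at the chart variable. [folklore] -/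
private theorem chartExponent_apply_self' [DecidableEq σ] (q : ℕ) (S : Finset σ) (j : σ)
    (d : σ →₀ ℕ) : chartExponent q S j d j = degIn S d - q := by
  unfold chartExponent
  rw [Finsupp.update_apply, if_pos rfl]

/-- A polynomial whose monomials all have degree `n` is a form of degree `n`. [folklore] -/
private theorem isHomogeneous_of_forall_degree' {ψ : MvPolynomial σ K} {n : ℕ}
    (h : ∀ d ∈ ψ.support, d.degree = n) : ψ.IsHomogeneous n := by
  rw [← ψ.support_sum_monomial_coeff]
  exact IsHomogeneous.sum _ _ _ fun d hd => isHomogeneous_monomial _ (h d hd)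

/-- The monomials of a form of degree `n` have degree `n`. [folklore] -/
private theorem degree_eq_of_mem_support' {ψ : MvPolynomial σ K} {n : ℕ} (hψ : ψ.IsHomogeneous n)
    {d : σ →₀ ℕ} (hd : d ∈ ψ.support) : d.degree = n := by
  by_contra h
  exact (MvPolynomial.mem_support_iff.mp hd) (hψ.coeff_eq_zero h)

/-- A partial derivative of a form of degree `n` is a form of degree `n − 1`. [folklore] -/
private theorem isHomogeneous_pderiv' {Θ : MvPolynomial σ K} {n : ℕ} (hΘ : Θ.IsHomogeneous n)
    (l : σ) : (pderiv l Θ).IsHomogeneous (n - 1) := by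
  refine isHomogeneous_of_forall_degree' fun e he => ?_
  have h := MvPolynomial.mem_support_iff.mp he
  rw [coeff_pderiv] at h
  have h1 : e + Finsupp.single l 1 ∈ Θ.support :=
    MvPolynomial.mem_support_iff.mpr (left_ne_zero_of_mul h)
  have h2 := degree_eq_of_mem_support' hΘ h1
  rw [map_add, Finsupp.degree_single] at h2
  omega

/-- `U_l ∂Θ/∂U_l` of a form `Θ` of degree `n` is a form of degree `n`. [folklore] -/
private theorem isHomogeneous_X_mul_pderiv' [DecidableEq σ] {Θ : MvPolynomial σ K} {n : ℕ}
    (hΘ : Θ.IsHomogeneous n) (l : σ) : (X l * pderiv l Θ).IsHomogeneous n := by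
  refine isHomogeneous_of_forall_degree' fun e he => ?_
  have h := MvPolynomial.mem_support_iff.mp he
  rw [PointBlowup.coeff_X_mul_pderiv] at h
  exact degree_eq_of_mem_support' hΘ (MvPolynomial.mem_support_iff.mpr (right_ne_zero_of_mul h))

/-- Dividing a form of degree `n` by a monomial `y^a` gives a form of degree `n − |a|`. [folklore] -/
private theorem isHomogeneous_divMonomial' {Θ : MvPolynomial σ K} {n : ℕ} (hΘ : Θ.IsHomogeneous n)
    (a : σ →₀ ℕ) : (Θ.divMonomial a).IsHomogeneous (n - a.degree) := by
  refine isHomogeneous_of_forall_degree' fun e he => ?_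
  have h := MvPolynomial.mem_support_iff.mp he
  rw [coeff_divMonomial] at h
  have h2 := degree_eq_of_mem_support' hΘ (MvPolynomial.mem_support_iff.mpr h)
  rw [map_add] at h2
  omega

/-- `U_l · (Θ / y^a) = (U_l Θ) / y^a` when `a_l = 0`. [folklore] -/
private theorem X_mul_divMonomial' [DecidableEq σ] (l : σ) {a : σ →₀ ℕ} (ha : a l = 0)
    (Θ : MvPolynomial σ K) : X l * Θ.divMonomial a = (X l * Θ).divMonomial a := by
  ext e
  rw [coeff_divMonomial, coeff_X_mul', coeff_X_mul', coeff_divMonomial]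
  have hl : l ∈ (a + e).support ↔ l ∈ e.support := by
    rw [Finsupp.mem_support_iff, Finsupp.mem_support_iff, Finsupp.add_apply, ha, zero_add]
  by_cases h : l ∈ e.support
  · rw [if_pos h, if_pos (hl.mpr h)]
    congr 1
    ext i
    rw [Finsupp.add_apply, Finsupp.tsub_apply, Finsupp.tsub_apply, Finsupp.add_apply,
      Finsupp.single_apply]
    by_cases hli : l = i
    · subst hli
      rw [if_pos rfl, ha, zero_add, zero_add]
    · rw [if_neg hli, Nat.sub_zero, Nat.sub_zero]
  · rw [if_neg h, if_neg (fun h' => h (hl.mp h'))]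

/-- Translation is multiplicative. [folklore] -/
private theorem translate_mul' (b : σ → K) (P Q : MvPolynomial σ K) :
    PointBlowup.translate b (P * Q) = PointBlowup.translate b P * PointBlowup.translate b Q := by
  unfold PointBlowup.translate
  rw [map_mul]

/-- The generators of the cone ideal of the zero polynomial vanish. [folklore] -/
private theorem eq_zero_of_mem_coneGens' [DecidableEq σ] (E : Finset σ) {F : MvPolynomial σ K}
    (hF : F = 0) {g : MvPolynomial σ K} (hg : g ∈ PointBlowup.coneGens E F) : g = 0 := by
  have h0 : initialForm F = 0 := by
    rw [hF]
    unfold HauserPerlega2019.initialForm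
    exact map_zero _
  unfold PointBlowup.coneGens at hg
  by_cases hV : PointBlowup.VNonzero E F
  · rw [if_pos hV] at hg
    have hg' : ∃ l, l ∉ E ∧ g = (pderiv l (initialForm F)).divMonomial (PointBlowup.bigHVec E F) := hg
    obtain ⟨l, -, rfl⟩ := hg'
    rw [h0, map_zero, zero_divMonomial]
  · rw [if_neg hV] at hg
    have hg' : ∃ l, l ∈ E ∧ g = (X l * pderiv l (initialForm F)).divMonomial (PointBlowup.bigHVec E F) :=
      hg
    obtain ⟨l, -, rfl⟩ := hg'
    rw [h0, map_zero, mul_zero, zero_divMonomial]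

end Helpers

/-! ### 1. Dehomogenisation `U_j ↦ 1` and the reading of `Max` of a form off its translates -/

section Dehomog

variable {σ : Type*} {K : Type*} [Field K] [Fintype σ] [DecidableEq σ]

/-- The dehomogenisation `U_j ↦ 1` (restriction to the affine chart `U_j = 1` of `Proj k[U]`).
[folklore] -/
private def dehom (j : σ) : MvPolynomial σ K →ₐ[K] MvPolynomial σ K :=
  aeval fun i => if i = j then (1 : MvPolynomial σ K) else X i

omit [Fintype σ] in
/-- `dehom` on a variable. [folklore] -/
private theorem dehom_X' (j i : σ) :
    dehom j (X i : MvPolynomial σ K) = if i = j then 1 else X i := by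
  unfold dehom
  rw [aeval_X]

/-- `dehom` on a monomial: `y^e ↦ y^{e ∖ j}`. [folklore] -/
private theorem dehom_monomial' (j : σ) (e : σ →₀ ℕ) (c : K) :
    dehom j (monomial e c) = monomial (e.erase j) c := by
  unfold dehom
  rw [aeval_monomial, algebraMap_eq, monomial_eq, Finsupp.prod_fintype _ _ (fun i => pow_zero _),
    Finsupp.prod_fintype _ _ (fun i => pow_zero _)]
  congr 1
  refine Finset.prod_congr rfl fun i _ => ?_
  by_cases hij : i = j
  · subst hij
    rw [if_pos rfl, one_pow, Finsupp.erase_same, pow_zero]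
  · rw [if_neg hij, Finsupp.erase_ne hij]

omit [Fintype σ] in
/-- Hauser's shear `U_i ↦ U_i + b_i U_j` conjugates the translation by the direction `e_j + b` into the
translation by `e_j` (`b_j = 0`). [folklore] -/
private theorem shear_translate_direction' (j : σ) (b : σ → K) (hbj : b j = 0) (P : MvPolynomial σ K) :
    shear j b (PointBlowup.translate (Function.update b j 1) P) =
      PointBlowup.translate (Function.update (0 : σ → K) j 1) (shear j b P) := by
  unfold shear PointBlowup.translate
  rw [← AlgHom.comp_apply, ← AlgHom.comp_apply, MvPolynomial.comp_aeval, MvPolynomial.comp_aeval]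
  congr 2
  funext i
  by_cases hij : i = j
  · subst hij
    simp only [Function.update_self, map_add, aeval_X, algHom_C, algebraMap_eq, if_true]
  · simp only [Function.update_of_ne hij, if_neg hij, map_add, map_mul, aeval_X, algHom_C,
      algebraMap_eq, Function.update_self, Pi.zero_apply, C_0, add_zero, map_one]
    ring

omit [Fintype σ] in
/-- The shear conjugates the dehomogenisation into `translate b ∘ dehom` (`b_j = 0`). [folklore] -/
private theorem dehom_shear' (j : σ) (b : σ → K) (hbj : b j = 0) (P : MvPolynomial σ K) :
    dehom j (shear j b P) = PointBlowup.translate b (dehom j P) := by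
  unfold shear PointBlowup.translate dehom
  rw [← AlgHom.comp_apply, ← AlgHom.comp_apply, MvPolynomial.comp_aeval, MvPolynomial.comp_aeval]
  congr 2
  funext i
  by_cases hij : i = j
  · subst hij
    simp only [if_true, aeval_X, map_one]
  · simp only [if_neg hij, map_add, map_mul, aeval_X, algHom_C, algebraMap_eq, if_true, mul_one]

omit [Fintype σ] in
/-- The shear maps forms to forms of the same degree. [folklore] -/
private theorem isHomogeneous_shear' (j : σ) (b : σ → K) {Θ : MvPolynomial σ K} {m : ℕ}
    (hΘ : Θ.IsHomogeneous m) : (shear j b Θ).IsHomogeneous m := by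
  have h := hΘ.aeval (fun i => if i = j then (X j : MvPolynomial σ K) else X i + C (b i) * X j)
    (n := 1) (fun i => by
      by_cases hij : i = j
      · rw [if_pos hij]
        exact isHomogeneous_X _ _
      · rw [if_neg hij]
        exact (isHomogeneous_X _ _).add (isHomogeneous_C_mul_X _ _))
  rw [one_mul] at h
  exact h

omit [Fintype σ] in
/-- Shearing back. [folklore] -/
private theorem shear_neg_shear' (j : σ) (b : σ → K) (P : MvPolynomial σ K) :
    shear j (fun i => -b i) (shear j b P) = P := by
  unfold shear
  rw [← AlgHom.comp_apply, MvPolynomial.comp_aeval]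
  have hfun : (fun i => aeval (fun i => if i = j then (X j : MvPolynomial σ K) else X i + C (-b i) * X j)
      (if i = j then (X j : MvPolynomial σ K) else X i + C (b i) * X j)) = X := by
    funext i
    by_cases hij : i = j
    · subst hij
      simp only [if_true, aeval_X]
    · simp only [if_neg hij, map_add, map_mul, aeval_X, algHom_C, algebraMap_eq, if_true, map_neg]
      ring
  rw [hfun, MvPolynomial.aeval_X_left, AlgHom.id_apply]

/-- A polynomial without `U_j` is invariant under `U_j ↦ U_j + 1`. [folklore] -/
private theorem translate_eq_self_of_apply_eq_zero' (j : σ) {Θ : MvPolynomial σ K}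
    (h : ∀ f ∈ Θ.support, f j = 0) :
    PointBlowup.translate (Function.update (0 : σ → K) j 1) Θ = Θ := by
  rw [PointBlowup.translate_eq_sum_support]
  conv_rhs => rw [← Θ.support_sum_monomial_coeff]
  refine Finset.sum_congr rfl fun f hf => ?_
  rw [WeightedBlowup.translate_monomial, monomial_eq, Finsupp.prod_fintype _ _ (fun i => pow_zero _)]
  congr 1
  refine Finset.prod_congr rfl fun i _ => ?_
  by_cases hij : i = j
  · subst hij
    rw [h f hf, pow_zero, pow_zero]
  · rw [Function.update_of_ne hij, Pi.zero_apply, C_0, add_zero]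

/-- A form of degree `m` all of whose monomials have `U_j`-free part of degree `≥ m` does not involve
`U_j`. [folklore] -/
private theorem apply_eq_zero_of_dehom_degree' (j : σ) {Θ : MvPolynomial σ K} {m : ℕ}
    (hΘ : Θ.IsHomogeneous m) (h : ∀ β ∈ (dehom j Θ).support, m ≤ β.degree) :
    ∀ f ∈ Θ.support, f j = 0 := by
  intro f hf
  have hfdeg : f.degree = m := degree_eq_of_mem_support' hΘ hf
  have hsplit : ∀ g : σ →₀ ℕ, (g.erase j).degree + g j = g.degree := fun g => by
    conv_rhs => rw [← Finsupp.erase_add_single j g]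
    rw [map_add, Finsupp.degree_single]
  have hsum : dehom j Θ = ∑ g ∈ Θ.support, monomial (g.erase j) (coeff g Θ) := by
    conv_lhs => rw [← Θ.support_sum_monomial_coeff]
    rw [map_sum]
    exact Finset.sum_congr rfl fun g _ => dehom_monomial' j g (coeff g Θ)
  have hcoeff : coeff (f.erase j) (dehom j Θ) = coeff f Θ := by
    rw [hsum]
    refine PointBlowup.coeff_sum_monomial_of_injOn Θ.support (fun g => g.erase j)
      (fun g => coeff g Θ) hf ?_
    intro g hg _ he
    have he' : g.erase j = f.erase j := he
    have hgdeg : g.degree = m := degree_eq_of_mem_support' hΘ hg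
    have h1 := hsplit g
    have h2 := hsplit f
    have hgj : g j = f j := by
      rw [he'] at h1
      omega
    rw [← Finsupp.erase_add_single j g, ← Finsupp.erase_add_single j f, he', hgj]
  have hmem : f.erase j ∈ (dehom j Θ).support := by
    rw [MvPolynomial.mem_support_iff, hcoeff]
    exact MvPolynomial.mem_support_iff.mp hf
  have hle := h _ hmem
  have h2 := hsplit f
  omega

/-- **`Max` of a form read off its translates, dehomogenised.**  For a form `Θ` of degree `m` and a
vector `b` with `b_j = 0`: if every monomial of `Θ(U + b)|_{U_j = 1}` has degree `≥ m`, then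
`Θ(U + e_j + b) = Θ(U)`, i.e. `e_j + b ∈ Max(Θ)`. [folklore] -/
private theorem inMax_of_forall_le_degree' (j : σ) (b : σ → K) (hbj : b j = 0) {Θ : MvPolynomial σ K}
    {m : ℕ} (hΘ : Θ.IsHomogeneous m)
    (h : ∀ β ∈ (PointBlowup.translate b (dehom j Θ)).support, m ≤ β.degree) :
    PointBlowup.InMax Θ (PointBlowup.direction j b) := by
  have hΘ' : (shear j b Θ).IsHomogeneous m := isHomogeneous_shear' j b hΘ
  have h' : ∀ β ∈ (dehom j (shear j b Θ)).support, m ≤ β.degree := by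
    rw [dehom_shear' j b hbj]
    exact h
  have hz := apply_eq_zero_of_dehom_degree' j hΘ' h'
  have hfix := translate_eq_self_of_apply_eq_zero' j hz
  have key : shear j b (PointBlowup.translate (Function.update b j 1) Θ) = shear j b Θ := by
    rw [shear_translate_direction' j b hbj, hfix]
  have := congrArg (shear j (fun i => -b i)) key
  rw [shear_neg_shear', shear_neg_shear'] at this
  exact this

/-- … contrapositively: off `Max(Θ)` the dehomogenised translate has a monomial of degree `< m`.
[folklore] -/
private theorem exists_degree_lt_of_not_inMax' (j : σ) (b : σ → K) (hbj : b j = 0)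
    {Θ : MvPolynomial σ K} {m : ℕ} (hΘ : Θ.IsHomogeneous m)
    (h : ¬ PointBlowup.InMax Θ (PointBlowup.direction j b)) :
    ∃ β ∈ (PointBlowup.translate b (dehom j Θ)).support, β.degree < m := by
  by_contra hc
  push Not at hc
  exact h (inMax_of_forall_le_degree' j b hbj hΘ hc)

end Dehomog

/-! ### 2. The unit lemma and the cone generators at a first-kind centre -/

section Unit

variable {σ : Type*} {K : Type*} [Field K] [Fintype σ] [DecidableEq σ] [DecidableEq K]

/-- **The unit lemma.**  For `β` of least degree among the monomials of `W`, the coefficient of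
`y^{ρ|_{b=0} + β}` in `(y + b)^ρ · W` is `(∏_{b_i ≠ 0} b_i^{ρ_i}) · coeff_β W ≠ 0`. [folklore] -/
private theorem coeff_translate_monomial_mul_ne_zero' (b : σ → K) (ρ : σ →₀ ℕ)
    (W : MvPolynomial σ K) {β : σ →₀ ℕ} (hβ : β ∈ W.support)
    (hmin : ∀ β' ∈ W.support, β.degree ≤ β'.degree) :
    coeff ((ρ.filter fun i => b i = 0) + β) (PointBlowup.translate b (monomial ρ 1) * W) ≠ 0 := by
  set ρZ : σ →₀ ℕ := ρ.filter fun i => b i = 0 with hρZ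
  rw [coeff_mul, Finset.sum_eq_single (ρZ, β)]
  · rw [WeightedBlowup.coeff_translate_monomial, one_mul]
    refine mul_ne_zero ?_ (MvPolynomial.mem_support_iff.mp hβ)
    rw [Finset.prod_ne_zero_iff]
    intro i _
    by_cases hbi : b i = 0
    · have : ρZ i = ρ i := by rw [hρZ, Finsupp.filter_apply, if_pos hbi]
      rw [this, Nat.choose_self, Nat.sub_self, pow_zero, mul_one, Nat.cast_one]
      exact one_ne_zero
    · have : ρZ i = 0 := by rw [hρZ, Finsupp.filter_apply, if_neg hbi]
      rw [this, Nat.choose_zero_right, Nat.sub_zero, Nat.cast_one, one_mul]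
      exact pow_ne_zero _ hbi
  · rintro ⟨γ, δ⟩ hx hne
    rw [Finset.mem_antidiagonal] at hx
    by_cases hγ0 : coeff γ (PointBlowup.translate b (monomial ρ (1 : K))) = 0
    · rw [hγ0, zero_mul]
    have hγZ : ∀ i, b i = 0 → γ i = ρ i := fun i hbi =>
      PointBlowup.apply_eq_of_coeff_translate_monomial_ne_zero b hbi hγ0
    have hρZγ : ρZ ≤ γ := by
      rw [Finsupp.le_def]
      intro i
      by_cases hbi : b i = 0
      · rw [hρZ, Finsupp.filter_apply, if_pos hbi, hγZ i hbi]
      · rw [hρZ, Finsupp.filter_apply, if_neg hbi]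
        exact Nat.zero_le _
    have hδle : δ ≤ β := by
      rw [Finsupp.le_def]
      intro i
      have h1 := DFunLike.congr_fun hx i
      simp only [Finsupp.coe_add, Pi.add_apply] at h1
      have h2 := Finsupp.le_def.mp hρZγ i
      omega
    rcases hδle.lt_or_eq with hlt | heq
    · have hδ0 : coeff δ W = 0 := by
        by_contra hne'
        exact absurd (hmin δ (MvPolynomial.mem_support_iff.mpr hne'))
          (not_le.mpr (PointBlowup.degree_lt_degree_of_lt hlt))
      rw [hδ0, mul_zero]
    · exfalso
      apply hne
      subst heq
      have h' : γ + δ = ρZ + δ := hx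
      rw [add_right_cancel h']
  · intro h
    exact (h (Finset.mem_antidiagonal.mpr rfl)).elim

omit [Fintype σ] [DecidableEq K] in
/-- **The cone generator, monomialwise**: for `F` of order `o` and `a ≤` every monomial of `F`,
`(U_l ∂F_{p,Z}/∂U_l) / y^a = Σ_{|d| = o} d_l c_d y^{d − a}`. [folklore] -/
private theorem X_mul_pderiv_initialForm_divMonomial_eq' {F : MvPolynomial σ K} {o : ℕ}
    (ho : ordZero F = o) (a : σ →₀ ℕ) (ha : ∀ d ∈ F.support, a ≤ d) (l : σ) :
    (X l * pderiv l (initialForm F)).divMonomial a =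
      ∑ d ∈ F.support.filter (fun d => d.degree = o),
        monomial (d - a) (((d l : ℕ) : K) * coeff d F) := by
  have hin : ∀ d, coeff d (initialForm F) = if d.degree = o then coeff d F else 0 := fun d => by
    unfold HauserPerlega2019.initialForm
    rw [coeff_homogeneousComponent, ho, ENat.toNat_coe]
  ext e
  rw [coeff_divMonomial, PointBlowup.coeff_X_mul_pderiv, hin]
  by_cases hT : a + e ∈ F.support.filter (fun d => d.degree = o)
  · obtain ⟨-, hdeg⟩ := Finset.mem_filter.mp hT
    rw [if_pos hdeg]
    have key := PointBlowup.coeff_sum_monomial_of_injOn (F.support.filter fun d => d.degree = o)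
      (fun d => d - a) (fun d => ((d l : ℕ) : K) * coeff d F) hT (by
        intro d hd _ h
        have h' : d - a = a + e - a := h
        have hd' := (Finset.mem_filter.mp hd).1
        calc d = d - a + a := (tsub_add_cancel_of_le (ha d hd')).symm
          _ = (a + e - a) + a := by rw [h']
          _ = a + e := by rw [add_tsub_cancel_left, add_comm])
    have key' : coeff (a + e - a) (∑ d ∈ F.support.filter (fun d => d.degree = o),
        monomial (d - a) (((d l : ℕ) : K) * coeff d F)) = (((a + e) l : ℕ) : K) * coeff (a + e) F :=
      key
    rw [add_tsub_cancel_left] at key'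
    exact key'.symm
  · have hzero : coeff e (∑ d ∈ F.support.filter (fun d => d.degree = o),
        monomial (d - a) (((d l : ℕ) : K) * coeff d F)) = 0 := by
      rw [coeff_sum]
      refine Finset.sum_eq_zero fun d hd => ?_
      rw [coeff_monomial, if_neg]
      intro h
      apply hT
      have : d = a + e := by
        rw [← h, add_tsub_cancel_of_le (ha d (Finset.mem_filter.mp hd).1)]
      rw [← this]
      exact hd
    rw [hzero]
    by_cases hdeg : (a + e).degree = o
    · rw [if_pos hdeg]
      have : coeff (a + e) F = 0 := by
        by_contra hne
        exact hT (Finset.mem_filter.mpr ⟨MvPolynomial.mem_support_iff.mpr hne, hdeg⟩)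
      rw [this, mul_zero]
    · rw [if_neg hdeg, mul_zero]

end Unit

/-! ### 3. Transport of the Jacobian module (duplicated from `CentreBlowupThm36Omega.lean`) -/

section Transport

variable {σ : Type*} {K : Type*} [Field K] [Fintype σ] [DecidableEq σ]
variable (p : ℕ) [hp : Fact p.Prime] [CharP K p]

omit [Fintype σ] hp [CharP K p] in
/-- `T(U_i ∂F/∂U_i) = (U_i + b_i) ∂G/∂U_i` for `i ≠ j`, `G` the translated chart transform.
[folklore] -/
private theorem transport_log_ne' (q : ℕ) (S : Finset σ) {j i : σ} (hij : i ≠ j) (b : σ → K)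
    (F : MvPolynomial σ K) :
    (X i + C (b i)) * pderiv i (PointBlowup.translate b (chartTransform q S j F)) =
      PointBlowup.translate b
        (∑ d ∈ F.support, monomial (chartExponent q S j d) (((d i : ℕ) : K) * coeff d F)) := by
  unfold chartTransform
  rw [PointBlowup.translate_finset_sum, PointBlowup.translate_finset_sum, map_sum (pderiv i),
    Finset.mul_sum]
  refine Finset.sum_congr rfl fun d _ => ?_
  rw [PointBlowup.pderiv_translate, ← PointBlowup.translate_X_mul, X_mul_pderiv_monomial',
    chartExponent_apply_of_ne' q S hij]

omit [Fintype σ] hp in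
/-- `U_j ∂G/∂U_j = T(D_S F)`, `D_S = Σ_{i∈S} U_i ∂/∂U_i`, in characteristic `p` (`b_j = 0`,
`deg_S ≥ p` on the monomials of `F`). [folklore] -/
private theorem transport_log_self' (S : Finset σ) (j : σ) (b : σ → K) (hbj : b j = 0)
    (F : MvPolynomial σ K) (hq : ∀ d ∈ F.support, p ≤ degIn S d) :
    X j * pderiv j (PointBlowup.translate b (chartTransform p S j F)) =
      PointBlowup.translate b
        (∑ d ∈ F.support, monomial (chartExponent p S j d) (((degIn S d : ℕ) : K) * coeff d F)) := by
  unfold chartTransform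
  rw [PointBlowup.translate_finset_sum, PointBlowup.translate_finset_sum, map_sum (pderiv j),
    Finset.mul_sum]
  refine Finset.sum_congr rfl fun d hd => ?_
  have hX : (X j : MvPolynomial σ K) = X j + C (b j) := by rw [hbj, C_0, add_zero]
  rw [PointBlowup.pderiv_translate, hX, ← PointBlowup.translate_X_mul, X_mul_pderiv_monomial',
    chartExponent_apply_self', Nat.cast_sub (hq d hd), CharP.cast_eq_zero K p, sub_zero]

omit [Fintype σ] hp in
/-- **Euler transport**: `T(U_j ∂F/∂U_j) = U_j ∂G/∂U_j − Σ_{i ∈ S∖j} (U_i + b_i) ∂G/∂U_i`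
(`j ∈ S`, `b_j = 0`, `deg_S ≥ p` on the monomials of `F`, characteristic `p`). [folklore] -/
private theorem transport_euler' (S : Finset σ) {j : σ} (hj : j ∈ S) (b : σ → K) (hbj : b j = 0)
    (F : MvPolynomial σ K) (hq : ∀ d ∈ F.support, p ≤ degIn S d) :
    PointBlowup.translate b
        (∑ d ∈ F.support, monomial (chartExponent p S j d) (((d j : ℕ) : K) * coeff d F)) =
      X j * pderiv j (PointBlowup.translate b (chartTransform p S j F)) -
        ∑ i ∈ S.erase j, (X i + C (b i)) * pderiv i (PointBlowup.translate b (chartTransform p S j F)) := by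
  rw [transport_log_self' p S j b hbj F hq]
  have hi : ∀ i ∈ S.erase j, (X i + C (b i)) * pderiv i (PointBlowup.translate b (chartTransform p S j F)) =
      PointBlowup.translate b
        (∑ d ∈ F.support, monomial (chartExponent p S j d) (((d i : ℕ) : K) * coeff d F)) :=
    fun i hi => transport_log_ne' p S (Finset.ne_of_mem_erase hi) b F
  rw [Finset.sum_congr rfl hi, ← PointBlowup.translate_finset_sum, ← PointBlowup.translate_sub]
  congr 1
  rw [Finset.sum_comm, ← Finset.sum_sub_distrib]
  refine Finset.sum_congr rfl fun d _ => ?_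
  rw [← map_sum, ← map_sub]
  congr 1
  rw [← Finset.sum_mul, ← sub_mul]
  congr 1
  have h := Finset.add_sum_erase S (fun i => d i) hj
  have h' : ((degIn S d : ℕ) : K) = ((d j : ℕ) : K) + ∑ i ∈ S.erase j, ((d i : ℕ) : K) := by
    rw [← Nat.cast_sum, ← Nat.cast_add]
    exact congrArg _ (by unfold degIn; exact h.symm)
  rw [h']
  ring

end Transport

/-! ### 4. The low monomial of the transported generator -/

section LowMonomial

variable {σ : Type*} {K : Type*} [Field K] [Fintype σ] [DecidableEq σ] [DecidableEq K]
variable (p : ℕ) [hp : Fact p.Prime] [CharP K p]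

omit hp [CharP K p] in
/-- **The low monomial.**  Let every monomial `y^d` of `F` have `|d| ≥ o` and `deg_S d ≥ k ≥ p`, the
initial ones (`|d| = o`) having `deg_S d = k`, and let the weighted chart image of the initial part
factor as `y^ρ · Θ` with `ρ_j = k − p` and `Θ` free of `U_j`.  For `β` of least degree among the
monomials of `translate_b Θ`, `y^{ρ|_{b=0} + β}` is a monomial of the translate of the whole weighted
chart transform `Σ_d w(d) c_d y^{d^S}` (the part coming from the non-initial monomials lives at other
(`y_j`-exponent, `Σ_{u∉S}`-degree) and cannot cancel it). [folklore] -/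
private theorem coeff_translate_ne_zero_of_factor' (S : Finset σ) {j : σ} (hj : j ∈ S) (b : σ → K)
    (hbj : b j = 0) (hbN : ∀ i, i ∉ S → b i = 0) (F : MvPolynomial σ K) {o k : ℕ} (hkp : p ≤ k)
    (hdeg : ∀ d ∈ F.support, o ≤ d.degree) (hdegIn : ∀ d ∈ F.support, k ≤ degIn S d)
    (hinit : ∀ d ∈ F.support, d.degree = o → degIn S d = k) (w : (σ →₀ ℕ) → K) (ρ : σ →₀ ℕ)
    (hρj : ρ j = k - p) (Θ : MvPolynomial σ K) (hΘj : ∀ e ∈ Θ.support, e j = 0)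
    (hfac : ∑ d ∈ F.support.filter (fun d => d.degree = o),
        monomial (chartExponent p S j d) (w d * coeff d F) = monomial ρ 1 * Θ)
    {β : σ →₀ ℕ} (hβ : β ∈ (PointBlowup.translate b Θ).support)
    (hmin : ∀ β' ∈ (PointBlowup.translate b Θ).support, β.degree ≤ β'.degree) :
    coeff ((ρ.filter fun i => b i = 0) + β) (PointBlowup.translate b
        (∑ d ∈ F.support, monomial (chartExponent p S j d) (w d * coeff d F))) ≠ 0 := by
  -- the initial part `Pc` and the rest `Pr`
  set T : Finset (σ →₀ ℕ) := F.support.filter (fun d => d.degree = o) with hT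
  set Pc : MvPolynomial σ K := ∑ d ∈ T, monomial (chartExponent p S j d) (w d * coeff d F) with hPc
  set Pr : MvPolynomial σ K := ∑ d ∈ F.support.filter (fun d => ¬ d.degree = o),
    monomial (chartExponent p S j d) (w d * coeff d F) with hPr
  have hsplit : (∑ d ∈ F.support, monomial (chartExponent p S j d) (w d * coeff d F)) = Pc + Pr := by
    rw [hPc, hPr, hT, Finset.sum_filter_add_sum_filter_not]
  have hmemT : ∀ d ∈ T, d ∈ F.support ∧ d.degree = o := fun d hd => Finset.mem_filter.mp hd
  set ρZ : σ →₀ ℕ := ρ.filter fun i => b i = 0 with hρZ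
  -- the initial part: the unit lemma
  have hA : coeff (ρZ + β) (PointBlowup.translate b Pc) ≠ 0 := by
    rw [hfac, translate_mul']
    exact coeff_translate_monomial_mul_ne_zero' b ρ _ hβ hmin
  -- `ν_j = ρ_j` for `ν = ρ_Z + β`
  have hβj : β j = 0 := by
    have h := MvPolynomial.mem_support_iff.mp hβ
    rw [PointBlowup.translate_eq_sum_support, coeff_sum] at h
    obtain ⟨e, he, hne⟩ := Finset.exists_ne_zero_of_sum_ne_zero h
    rw [PointBlowup.apply_eq_of_coeff_translate_monomial_ne_zero b hbj hne]
    exact hΘj e he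
  have hνj : (ρZ + β) j = ρ j := by
    rw [Finsupp.add_apply, hρZ, Finsupp.filter_apply, if_pos hbj, hβj, add_zero]
  -- `ν` records the `Σ_{u ∉ S}`-degree `o − k` of the initial monomials
  have hνN : k ≤ o ∧ ∑ u ∈ Sᶜ, (ρZ + β) u = o - k := by
    have h := hA
    rw [hPc, PointBlowup.translate_finset_sum, coeff_sum] at h
    obtain ⟨d, hd, hne⟩ := Finset.exists_ne_zero_of_sum_ne_zero h
    have hdu : ∀ u ∈ Sᶜ, (ρZ + β) u = d u := fun u hu => by
      have huS : u ∉ S := Finset.mem_compl.mp hu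
      have huj : u ≠ j := fun h => huS (h ▸ hj)
      rw [PointBlowup.apply_eq_of_coeff_translate_monomial_ne_zero b (hbN u huS) hne,
        chartExponent_apply_of_ne' p S huj]
    have hsum : ∑ u ∈ Sᶜ, (ρZ + β) u = ∑ u ∈ Sᶜ, d u := Finset.sum_congr rfl hdu
    have h1 : degIn S d + ∑ u ∈ Sᶜ, d u = d.degree := degIn_add_sum_compl S d
    have h2 : degIn S d = k := hinit d (hmemT d hd).1 (hmemT d hd).2
    have h3 : d.degree = o := (hmemT d hd).2
    have h4 := degIn_le_degree S d
    constructor <;> omega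
  obtain ⟨hko, hνN⟩ := hνN
  -- the rest does not contribute at `ν`
  have hzero : coeff (ρZ + β) (PointBlowup.translate b Pr) = 0 := by
    rw [hPr, PointBlowup.translate_finset_sum, coeff_sum]
    refine Finset.sum_eq_zero fun d hd => ?_
    obtain ⟨hdF, hdo⟩ := Finset.mem_filter.mp hd
    by_contra hne
    have hjeq := PointBlowup.apply_eq_of_coeff_translate_monomial_ne_zero b hbj hne
    rw [chartExponent_apply_self', hνj, hρj] at hjeq
    have hk : degIn S d = k := by
      have := hdegIn d hdF
      omega
    have hdu : ∀ u ∈ Sᶜ, (ρZ + β) u = d u := fun u hu => by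
      have huS : u ∉ S := Finset.mem_compl.mp hu
      have huj : u ≠ j := fun h => huS (h ▸ hj)
      rw [PointBlowup.apply_eq_of_coeff_translate_monomial_ne_zero b (hbN u huS) hne,
        chartExponent_apply_of_ne' p S huj]
    have hsum : ∑ u ∈ Sᶜ, (ρZ + β) u = ∑ u ∈ Sᶜ, d u := Finset.sum_congr rfl hdu
    have h1 : degIn S d + ∑ u ∈ Sᶜ, d u = d.degree := degIn_add_sum_compl S d
    have h2 : o ≤ d.degree := hdeg d hdF
    apply hdo
    omega
  have htadd : PointBlowup.translate b (Pc + Pr) =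
      PointBlowup.translate b Pc + PointBlowup.translate b Pr := by
    unfold PointBlowup.translate
    rw [map_add]
  rw [hsplit, htadd, coeff_add, hzero, add_zero]
  exact hA

end LowMonomial

/-! ### 5. Reading `ω(x')` (duplicated from `CentreBlowupThm36Omega.lean`) -/

section Reading

variable {σ : Type*} {K : Type*} [Field K] [Fintype σ] [DecidableEq σ] [DecidableEq K]
variable (p : ℕ) [hp : Fact p.Prime] [CharP K p]

omit [Fintype σ] [DecidableEq K] hp [CharP K p] in
/-- A monomial with an exponent prime to `p` survives the cleaning. [folklore] -/
private theorem coeff_deletePthPowers_of_not_dvd' (G : MvPolynomial σ K) {e : σ →₀ ℕ} {i : σ}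
    (hi : ¬ p ∣ e i) : coeff e (deletePthPowers p G) = coeff e G := by
  rw [coeff_deletePthPowers, if_neg]
  intro h
  exact hi ((isPthPowerExponent_iff p e).mp h i)

omit [Fintype σ] [DecidableEq K] hp [CharP K p] in
/-- **`ord₀ F' ≤ |r'| + m` gives `ω(x') ≤ m`**: a monomial of the transform `G`, surviving the cleaning,
of degree `≤ |r'| + m`, where `ε(x') ≤ ord₀ F' − |r'|`. [folklore] -/
private theorem omega_le_of_low_monomial' (s' : CState σ K) (G : MvPolynomial σ K)
    (hF' : s'.F = deletePthPowers p G) (R : ℕ) (hε : s'.epsilon ≤ ordZero s'.F - (R : ℕ∞))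
    {e : σ →₀ ℕ} (he : coeff e G ≠ 0) {i : σ} (hi : ¬ p ∣ e i) {m : ℕ} (hdeg : e.degree ≤ R + m) :
    s'.omega ≤ (m : ℕ∞) := by
  have he' : coeff e s'.F ≠ 0 := by rwa [hF', coeff_deletePthPowers_of_not_dvd' p G hi]
  have ho : ordZero s'.F ≤ (e.degree : ℕ∞) := ordZero_le_of_coeff_ne_zero _ e he'
  calc s'.omega ≤ s'.epsilon := CState.omega_le_epsilon s'
    _ ≤ ordZero s'.F - (R : ℕ∞) := hε
    _ ≤ (e.degree : ℕ∞) - (R : ℕ∞) := tsub_le_tsub_right ho _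
    _ ≤ (m : ℕ∞) := by
        rw [← ENat.coe_sub]
        exact_mod_cast (by omega : e.degree - R ≤ m)

omit [Fintype σ] [DecidableEq K] hp in
/-- **A `V`-witness of `F'` in degree `≤ |r'| + m + 1` gives `ω(x') ≤ m`**: a monomial of `G` with an
exponent prime to `p` at a variable `t ∉ E'`, of degree `≤ |r'| + m + 1`; either it is initial in `F'`
(then `V(F'_{p,Z'},E') ≠ 0` and `ω(x') = ε(x') − 1`) or `ord₀ F'` is smaller. [folklore] -/
private theorem omega_le_of_low_witness' (s' : CState σ K) (G : MvPolynomial σ K)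
    (hF' : s'.F = deletePthPowers p G) (R : ℕ) (hε : s'.epsilon ≤ ordZero s'.F - (R : ℕ∞))
    {e : σ →₀ ℕ} (he : coeff e G ≠ 0) {t : σ} (ht : t ∉ s'.exc) (hpt : ¬ p ∣ e t) {m : ℕ}
    (hdeg : e.degree ≤ R + m + 1) : s'.omega ≤ (m : ℕ∞) := by
  have he' : coeff e s'.F ≠ 0 := by rwa [hF', coeff_deletePthPowers_of_not_dvd' p G hpt]
  have hF0 : s'.F ≠ 0 := MvPolynomial.ne_zero_iff.mpr ⟨e, he'⟩
  obtain ⟨o', ho'⟩ := exists_ordZero_eq' hF0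
  have hole : o' ≤ e.degree := by
    have := ordZero_le_of_coeff_ne_zero _ e he'
    rw [ho'] at this
    exact_mod_cast this
  rcases hole.lt_or_eq with hlt | heq
  · calc s'.omega ≤ s'.epsilon := CState.omega_le_epsilon s'
      _ ≤ ordZero s'.F - (R : ℕ∞) := hε
      _ ≤ (m : ℕ∞) := by
          rw [ho', ← ENat.coe_sub]
          exact_mod_cast (by omega : o' - R ≤ m)
  · have het : 1 ≤ e t := Nat.one_le_iff_ne_zero.mpr fun h => hpt (h ▸ dvd_zero p)
    have hV : PointBlowup.VNonzero s'.exc s'.F := by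
      refine ⟨t, ht, MvPolynomial.ne_zero_iff.mpr ⟨e - Finsupp.single t 1, ?_⟩⟩
      have hsub : e - Finsupp.single t 1 + Finsupp.single t 1 = e :=
        tsub_add_cancel_of_le (Finsupp.single_le_iff.mpr (by simpa using het))
      rw [coeff_pderiv, hsub]
      have hinit : coeff e (initialForm s'.F) = coeff e s'.F := by
        unfold HauserPerlega2019.initialForm
        rw [coeff_homogeneousComponent, if_pos]
        rw [ho', heq]
        rfl
      rw [hinit]
      refine mul_ne_zero he' ?_
      have hcast : (((e - Finsupp.single t 1 : σ →₀ ℕ) t : ℕ) : K) + 1 = ((e t : ℕ) : K) := by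
        rw [← Nat.cast_succ]
        congr 1
        rw [Finsupp.tsub_apply, Finsupp.single_eq_same]
        omega
      rw [hcast, Ne, CharP.cast_eq_zero_iff K p]
      exact hpt
    rw [CState.omega_eq_of_vNonzero s' hV]
    refine tsub_le_iff_right.mpr ?_
    calc s'.epsilon ≤ ordZero s'.F - (R : ℕ∞) := hε
      _ ≤ ((m + 1 : ℕ) : ℕ∞) := by
          rw [ho', ← ENat.coe_sub]
          exact_mod_cast (by omega : o' - R ≤ m + 1)
      _ = (m : ℕ∞) + 1 := Nat.cast_add_one m

omit [Fintype σ] hp in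
/-- **Landing.** A monomial `y^ν` of degree `≤ |r'| + m` of `U_j ∂G/∂U_j`, or of `(U_i + b_i)∂G/∂U_i`
for some `i ≠ j`, gives `ω(x') ≤ m`. [folklore] -/
private theorem omega_le_of_landing' (S : Finset σ) (j : σ) (b : σ → K) (s : CState σ K) (R : ℕ)
    (hε : (step p S j b s).epsilon ≤ ordZero (step p S j b s).F - (R : ℕ∞)) {ν : σ →₀ ℕ} {m : ℕ}
    (hν : ν.degree ≤ R + m)
    (h : coeff ν (X j * pderiv j (pointTransform p S j b s)) ≠ 0 ∨
      ∃ i, i ≠ j ∧ coeff ν ((X i + C (b i)) * pderiv i (pointTransform p S j b s)) ≠ 0) :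
    (step p S j b s).omega ≤ (m : ℕ∞) := by
  set G := pointTransform p S j b s with hG
  have hF' : (step p S j b s).F = deletePthPowers p G := rfl
  have key : ∀ i, coeff ν G ≠ 0 → (((ν i : ℕ) : K)) ≠ 0 → (step p S j b s).omega ≤ (m : ℕ∞) := by
    intro i hc hi
    have hndvd : ¬ p ∣ ν i := by rwa [Ne, CharP.cast_eq_zero_iff K p] at hi
    exact omega_le_of_low_monomial' p _ G hF' R hε hc hndvd hν
  rcases h with h | ⟨i, hij, h⟩
  · rw [PointBlowup.coeff_X_mul_pderiv] at h
    exact key j (right_ne_zero_of_mul h) (left_ne_zero_of_mul h)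
  · rw [add_mul, coeff_add, PointBlowup.coeff_X_mul_pderiv, coeff_C_mul, coeff_pderiv] at h
    by_cases h1 : ((ν i : ℕ) : K) * coeff ν G = 0
    · rw [h1, zero_add] at h
      have hbi : b i ≠ 0 := left_ne_zero_of_mul h
      have h2 := right_ne_zero_of_mul h
      have hc : coeff (ν + Finsupp.single i 1) G ≠ 0 := left_ne_zero_of_mul h2
      have hk : ((ν i : ℕ) : K) + 1 ≠ 0 := right_ne_zero_of_mul h2
      have hndvd : ¬ p ∣ (ν + Finsupp.single i 1 : σ →₀ ℕ) i := by
        rw [Finsupp.add_apply, Finsupp.single_eq_same, ← CharP.cast_eq_zero_iff K p, Nat.cast_succ]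
        exact hk
      have hiE : i ∉ (step p S j b s).exc := by
        show i ∉ newExc j b s
        unfold newExc
        rw [Finset.mem_insert, Finset.mem_filter, not_or]
        exact ⟨hij, fun h => hbi h.2⟩
      refine omega_le_of_low_witness' p _ G hF' R hε hc hiE hndvd ?_
      rw [map_add, Finsupp.degree_single]
      omega
    · exact key i (right_ne_zero_of_mul h1) (left_ne_zero_of_mul h1)

end Reading

/-! ### 6. The estimate off the cone -/

section Main

variable {σ : Type*} {K : Type*} [Field K] [Fintype σ] [DecidableEq σ] [DecidableEq K]
variable (p : ℕ) [hp : Fact p.Prime] [CharP K p]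

omit [DecidableEq K] hp [CharP K p] in
/-- The numbers at a first-kind centre with `ord₀ F = o`, in `ℕ`: with `H = H|_exc` and
`k := deg_S H + (o − |H|)` one has `q ≤ k ≤ deg_S d`, `H ≤ d`, `|d| ≥ o` for every monomial `y^d` of
`F`, `deg_S d = k` for the initial ones, `|H| ≤ o`, and `H_i = 0` off `exc`.
[cite: CossartPiltant2019, Def. 3.1 and Prop. 3.1 (p. 31)] -/
private theorem firstKind_bookkeeping' {q : ℕ} {S : Finset σ} {s : CState σ K}
    (h1 : IsFirstKind q S s) {o : ℕ} (ho : ordZero s.F = o) :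
    q ≤ degIn S (PointBlowup.bigHVec s.exc s.F) + (o - (PointBlowup.bigHVec s.exc s.F).degree) ∧
    (∀ d ∈ s.F.support, degIn S (PointBlowup.bigHVec s.exc s.F) +
        (o - (PointBlowup.bigHVec s.exc s.F).degree) ≤ degIn S d) ∧
    (∀ d ∈ s.F.support, PointBlowup.bigHVec s.exc s.F ≤ d) ∧
    (∀ d ∈ s.F.support, o ≤ d.degree) ∧
    (∀ d ∈ s.F.support, d.degree = o → degIn S d = degIn S (PointBlowup.bigHVec s.exc s.F) +
        (o - (PointBlowup.bigHVec s.exc s.F).degree)) ∧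
    (PointBlowup.bigHVec s.exc s.F).degree ≤ o ∧
    (∀ i, i ∉ s.exc → PointBlowup.bigHVec s.exc s.F i = 0) := by
  obtain ⟨⟨-, hqord⟩, hii⟩ := h1
  have hF : s.F ≠ 0 := ne_zero_of_ordZero_eq' ho
  set Hv := PointBlowup.bigHVec s.exc s.F with hHv
  have hr : ∀ d ∈ s.F.support, Hv ≤ d := bigHVec_le' s.exc s.F
  have hne : s.F.support.Nonempty := MvPolynomial.support_nonempty.mpr hF
  obtain ⟨d₀, hd₀, hdeg⟩ :=
    Finset.exists_mem_eq_inf s.F.support hne (fun d : σ →₀ ℕ => (degIn S d : ℕ∞))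
  have hoS : ordAlong S s.F = (degIn S d₀ : ℕ∞) := hdeg
  have hmin : ∀ d ∈ s.F.support, degIn S d₀ ≤ degIn S d := fun d hd => by
    have h : ordAlong S s.F ≤ (degIn S d : ℕ∞) := Finset.inf_le hd
    rw [hoS] at h
    exact_mod_cast h
  obtain ⟨⟨d₁, hd₁, hdeg₁⟩, hlow⟩ := (ordZero_eq_nat_iff s.F o).mp ho
  have hd₁' : d₁ ∈ s.F.support := MvPolynomial.mem_support_iff.mpr hd₁
  have hodeg : ∀ d ∈ s.F.support, o ≤ d.degree := fun d hd => by
    by_contra hlt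
    exact (MvPolynomial.mem_support_iff.mp hd) (hlow d (not_le.mp hlt))
  have hB : Hv.degree ≤ o := le_of_le_of_eq (PointBlowup.degree_le_degree_of_le (hr d₁ hd₁')) hdeg₁
  have hdegInHv : degIn S Hv = ∑ i ∈ S ∩ s.exc, Hv i := by
    unfold degIn
    exact (Finset.sum_subset Finset.inter_subset_left fun i hiS hi => by
      rw [hHv, bigHVec_apply', if_neg (fun hiE => hi (Finset.mem_inter.mpr ⟨hiS, hiE⟩))]).symm
  have hsumE : ∀ E : Finset σ, E ⊆ s.exc →
      ∑ i ∈ E, PointBlowup.bigH s.F i = ((∑ i ∈ E, Hv i : ℕ) : ℕ∞) := fun E hE => by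
    rw [Nat.cast_sum]
    refine Finset.sum_congr rfl fun i hi => ?_
    rw [bigH_eq_toNat' hF i, hHv, bigHVec_apply', if_pos (hE hi)]
  have hnat : degIn S d₀ - ∑ i ∈ S ∩ s.exc, Hv i = o - Hv.degree := by
    have h := hii
    unfold epsilonAlong at h
    rw [CState.epsilon_eq, hoS, ho, hsumE _ Finset.inter_subset_right, sum_bigH_eq' hF,
      ← ENat.coe_sub, ← ENat.coe_sub] at h
    exact_mod_cast h
  have hA : ∑ i ∈ S ∩ s.exc, Hv i ≤ degIn S d₀ := by
    rw [← hdegInHv]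
    exact degIn_le_degIn_of_le S (hr d₀ hd₀)
  have hk : degIn S Hv + (o - Hv.degree) = degIn S d₀ := by
    rw [hdegInHv]
    omega
  have hq0 : q ≤ degIn S d₀ := by
    rw [hoS] at hqord
    exact_mod_cast hqord
  refine ⟨hk ▸ hq0, fun d hd => hk ▸ hmin d hd, hr, hodeg, ?_, hB, ?_⟩
  · intro d hd hdo
    refine le_antisymm ?_ (hk ▸ hmin d hd)
    have h1 := degIn_add_sum_compl S d
    have h2 := degIn_add_sum_compl S Hv
    have h3 : ∑ u ∈ Sᶜ, Hv u ≤ ∑ u ∈ Sᶜ, d u :=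
      Finset.sum_le_sum fun u _ => Finsupp.le_def.mp (hr d hd) u
    omega
  · intro i hi
    rw [hHv, bigHVec_apply', if_neg hi]

omit hp [CharP K p] in
/-- After the `C_S`-step, `ε(x')` is dominated by the shade of the step of the auxiliary Moh state
`(F, H|_exc, exc)`: `ε(x') ≤ ord₀ F' − |r'|`. [folklore] -/
private theorem epsilon_step_le_sub' (q : ℕ) (S : Finset σ) (j : σ) (b : σ → K)
    (hbj : b j = 0) (s : CState σ K) {o : ℕ} (ho : ordZero s.F = o)
    (hperm : ∀ d ∈ s.F.support, degIn S (PointBlowup.bigHVec s.exc s.F) +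
      (o - (PointBlowup.bigHVec s.exc s.F).degree) ≤ degIn S d) :
    (step q S j b s).epsilon ≤ ordZero (step q S j b s).F -
      (((step q S j b ⟨s.F, PointBlowup.bigHVec s.exc s.F, s.exc⟩).r.degree : ℕ) : ℕ∞) := by
  set t : CState σ K := ⟨s.F, PointBlowup.bigHVec s.exc s.F, s.exc⟩ with ht
  have hF' : (step q S j b t).F = (step q S j b s).F := rfl
  have hr : ∀ d ∈ t.F.support, t.r ≤ d := bigHVec_le' s.exc s.F
  have hρ : ∀ e ∈ (step q S j b t).F.support, (step q S j b t).r ≤ e :=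
    newMult_le_of_mem_support_step q S j b hbj t ho hr hperm
  have hρeq : (step q S j b t).r =
      (t.r.update j (degIn S t.r + (o - t.r.degree) - q)).filter (fun i => b i = 0) :=
    step_r_eq q S j b hbj t ho hr hperm
  have hsub : ∀ i, (step q S j b t).r i ≠ 0 → i ∈ (step q S j b s).exc := by
    intro i hi
    rw [hρeq, Finsupp.filter_apply] at hi
    show i ∈ insert j (s.exc.filter fun i => b i = 0)
    rw [mem_insert, mem_filter]
    by_cases hij : i = j
    · exact Or.inl hij
    · right
      split_ifs at hi with hb
      · rw [Finsupp.update_apply, if_neg hij] at hi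
        have hiE : i ∈ s.exc := by
          by_contra hiE
          apply hi
          show PointBlowup.bigHVec s.exc s.F i = 0
          rw [bigHVec_apply', if_neg hiE]
        exact ⟨hiE, hb⟩
      · exact absurd rfl hi
  have h1 : (((step q S j b t).r.degree : ℕ) : ℕ∞) ≤
      ∑ i ∈ (step q S j b s).exc, PointBlowup.bigH (step q S j b s).F i :=
    calc (((step q S j b t).r.degree : ℕ) : ℕ∞)
        = ∑ i ∈ (step q S j b t).r.support, (((step q S j b t).r i : ℕ) : ℕ∞) := by
          rw [Finsupp.degree_apply, Nat.cast_sum]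
      _ ≤ ∑ i ∈ (step q S j b s).exc, (((step q S j b t).r i : ℕ) : ℕ∞) :=
          Finset.sum_le_sum_of_subset_of_nonneg
            (fun i hi => hsub i (Finsupp.mem_support_iff.mp hi)) (fun _ _ _ => zero_le)
      _ ≤ ∑ i ∈ (step q S j b s).exc, PointBlowup.bigH (step q S j b s).F i :=
          Finset.sum_le_sum fun i _ =>
            Finset.le_inf fun e he => by
              exact_mod_cast Finsupp.le_def.mp (hρ e (hF' ▸ he)) i
  rw [CState.epsilon_eq]
  exact tsub_le_tsub_left h1 _

omit hp in
/-- **The estimate off the cone.**  At a first-kind centre with `ord₀ F = o`, let `U_l` be a variable and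
suppose the dehomogenised translate `W = translate_b((H⁻¹U_l ∂F_{p,Z}/∂U_l)|_{U_j = 1})` has a monomial
of degree `≤ m + δ`, where `δ = 0`, or `δ = 1` and `l ≠ j`, `b_l = 0`, `l ∉ E` (so that `U_l` is not a
component of `E'`).  Then `ω(x') ≤ m`. [cite: CossartPiltant2019, Thm. 3.6 (p. 35), proof p. 36 (3.6.9.1)] -/
private theorem omega_step_le_cone_core' {S : Finset σ} {j : σ} (hj : j ∈ S) (b : σ → K)
    (hbj : b j = 0) (hbN : ∀ i, i ∉ S → b i = 0) (s : CState σ K) (h1 : IsFirstKind p S s) {o : ℕ}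
    (ho : ordZero s.F = o) (l : σ) {m δ : ℕ} (hδ : δ ≤ 1)
    (hδ1 : δ = 1 → l ≠ j ∧ b l = 0 ∧ l ∉ s.exc)
    (hex : ∃ β ∈ (PointBlowup.translate b (dehom j
        ((X l * pderiv l (initialForm s.F)).divMonomial (PointBlowup.bigHVec s.exc s.F)))).support,
        β.degree ≤ m + δ) :
    (step p S j b s).omega ≤ (m : ℕ∞) := by
  obtain ⟨hpk, hdegIn, hr, hdeg, hinit, -, -⟩ := firstKind_bookkeeping' h1 ho
  set Hv := PointBlowup.bigHVec s.exc s.F with hHv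
  set k := degIn S Hv + (o - Hv.degree) with hk
  have hq : ∀ d ∈ s.F.support, p ≤ degIn S d := fun d hd => le_trans hpk (hdegIn d hd)
  -- the new record `R` of the auxiliary state and `ε(x') ≤ ord₀ F' − |R|`
  set t : CState σ K := ⟨s.F, Hv, s.exc⟩ with ht
  have hRdef : (step p S j b t).r = (Hv.update j (k - p)).filter (fun i => b i = 0) :=
    step_r_eq p S j b hbj t ho hr hdegIn
  set R := (step p S j b t).r with hR
  have hε := epsilon_step_le_sub' p S j b hbj s ho hdegIn
  rw [← ht, ← hR] at hε
  set ρ₀ : σ →₀ ℕ := Hv.update j (k - p) with hρ₀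
  have hρ₀R : (ρ₀.filter fun i => b i = 0).degree = R.degree := by rw [hRdef]
  have hρ₀j : ρ₀ j = k - p := by rw [hρ₀, Finsupp.update_apply, if_pos rfl]
  have hρ₀i : ∀ i, i ≠ j → ρ₀ i = Hv i := fun i hi => by rw [hρ₀, Finsupp.update_apply, if_neg hi]
  -- the generator, dehomogenised: `Θ = Σ_{d initial} d_l c_d y^{(d − H) ∖ j}`
  set T : Finset (σ →₀ ℕ) := s.F.support.filter (fun d => d.degree = o) with hT
  have hmemT : ∀ d ∈ T, d ∈ s.F.support ∧ d.degree = o := fun d hd => Finset.mem_filter.mp hd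
  set Θ : MvPolynomial σ K := dehom j ((X l * pderiv l (initialForm s.F)).divMonomial Hv) with hΘ
  have hΓ : (X l * pderiv l (initialForm s.F)).divMonomial Hv =
      ∑ d ∈ T, monomial (d - Hv) (((d l : ℕ) : K) * coeff d s.F) :=
    X_mul_pderiv_initialForm_divMonomial_eq' ho Hv hr l
  have hΘsum : Θ = ∑ d ∈ T, monomial ((d - Hv).erase j) (((d l : ℕ) : K) * coeff d s.F) := by
    rw [hΘ, hΓ, map_sum]
    exact Finset.sum_congr rfl fun d _ => dehom_monomial' j _ _
  have hΘj : ∀ e ∈ Θ.support, e j = 0 := by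
    intro e he
    rw [hΘsum] at he
    obtain ⟨d, -, -, rfl⟩ := PointBlowup.exists_of_mem_support_sum_monomial T _ _ he
    exact Finsupp.erase_same
  have hfac : ∑ d ∈ T, monomial (chartExponent p S j d) (((d l : ℕ) : K) * coeff d s.F) =
      monomial ρ₀ 1 * Θ := by
    rw [hΘsum, Finset.mul_sum]
    refine Finset.sum_congr rfl fun d hd => ?_
    obtain ⟨hdF, hdo⟩ := hmemT d hd
    have hexp : chartExponent p S j d = ρ₀ + (d - Hv).erase j := by
      ext i
      rw [Finsupp.add_apply]
      by_cases hij : i = j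
      · rw [hij, chartExponent_apply_self', hinit d hdF hdo, hρ₀j, Finsupp.erase_same, add_zero]
      · rw [chartExponent_apply_of_ne' p S hij, hρ₀i i hij, Finsupp.erase_ne hij, Finsupp.tsub_apply,
          add_tsub_cancel_of_le (Finsupp.le_def.mp (hr d hdF) i)]
    rw [monomial_mul, one_mul, hexp]
  -- a monomial of least degree of `translate b Θ`
  obtain ⟨β₁, hβ₁, hβ₁deg⟩ := hex
  have hne : (PointBlowup.translate b Θ).support.Nonempty := ⟨β₁, hβ₁⟩
  obtain ⟨β, hβ, hβmin⟩ := Finset.exists_min_image _ (fun β : σ →₀ ℕ => β.degree) hne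
  have hβdeg : β.degree ≤ m + δ := le_trans (hβmin β₁ hβ₁) hβ₁deg
  -- the low monomial `ν = R + β` of `T(U_l ∂F/∂U_l)`
  have hν := coeff_translate_ne_zero_of_factor' p S hj b hbj hbN s.F hpk hdeg hdegIn hinit
    (fun d => ((d l : ℕ) : K)) ρ₀ hρ₀j Θ hΘj hfac hβ hβmin
  set ν : σ →₀ ℕ := (ρ₀.filter fun i => b i = 0) + β with hνdef
  have hνdeg : ν.degree ≤ R.degree + m + δ := by
    rw [hνdef, map_add, hρ₀R]
    omega
  by_cases hlj : l = j
  · -- ### the chart variable: Euler transport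
    have hδ0 : δ = 0 := by
      rcases Nat.le_one_iff_eq_zero_or_eq_one.mp hδ with h | h
      · exact h
      · exact absurd hlj (hδ1 h).1
    subst hlj
    rw [transport_euler' p S hj b hbj s.F hq, coeff_sub, coeff_sum] at hν
    have hν' : coeff ν (X l * pderiv l (pointTransform p S l b s)) -
        ∑ i ∈ S.erase l, coeff ν ((X i + C (b i)) * pderiv i (pointTransform p S l b s)) ≠ 0 := hν
    rw [hδ0, add_zero] at hνdeg
    refine omega_le_of_landing' p S l b s R.degree hε hνdeg ?_
    by_cases hjj : coeff ν (X l * pderiv l (pointTransform p S l b s)) ≠ 0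
    · exact Or.inl hjj
    · right
      rw [not_not] at hjj
      rw [hjj, zero_sub, neg_ne_zero] at hν'
      obtain ⟨i, hi, hne'⟩ := Finset.exists_ne_zero_of_sum_ne_zero hν'
      exact ⟨i, Finset.ne_of_mem_erase hi, hne'⟩
  · -- ### a variable `l ≠ j`: transport `(U_l + b_l) ∂G/∂U_l`
    rw [← transport_log_ne' p S hlj b s.F] at hν
    rcases Nat.le_one_iff_eq_zero_or_eq_one.mp hδ with hδ0 | hδ1'
    · rw [hδ0, add_zero] at hνdeg
      exact omega_le_of_landing' p S j b s R.degree hε hνdeg (Or.inr ⟨l, hlj, hν⟩)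
    · obtain ⟨-, hbl, hlE⟩ := hδ1 hδ1'
      rw [hbl, C_0, add_zero, PointBlowup.coeff_X_mul_pderiv] at hν
      have hc : coeff ν (pointTransform p S j b s) ≠ 0 := right_ne_zero_of_mul hν
      have hνl : ¬ p ∣ ν l := by
        rw [← CharP.cast_eq_zero_iff K p]
        exact left_ne_zero_of_mul hν
      have hlE' : l ∉ (step p S j b s).exc := by
        show l ∉ newExc j b s
        unfold newExc
        rw [Finset.mem_insert, Finset.mem_filter, not_or]
        exact ⟨hlj, fun h => hlE h.1⟩
      rw [hδ1'] at hνdeg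
      exact omega_le_of_low_witness' p _ _ rfl R.degree hε hc hlE' hνl hνdeg

end Main

end CentreBlowup

/-! ### 7. The theorems -/

namespace CentreBlowup.CState

section Cone

variable {σ : Type*} {K : Type*} [Field K] [Fintype σ] [DecidableEq σ] [DecidableEq K]
variable (p : ℕ) [hp : Fact p.Prime] [CharP K p]

omit hp in
/-- **[CP19, Thm. 3.6, proof (3.6.9.1)] `s' ∉ PC(x,𝒴) ⟹ ω(x') < ω(x)` under the blow-up of a permissible
centre OF THE FIRST KIND, in the model**: at every point `b` of the fibre over `x` in every chart `j ∈ S`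
whose direction `e_j + Σ b_i e_i` is not in `Max(x)` (some cone generator is not translation invariant
along it), `ω` drops.  No cleanliness, equimultiplicity or `ω(x) > 0` is needed.
[cite: CossartPiltant2019, Thm. 3.6 (p. 35), proof p. 36] -/
theorem omega_step_lt_of_not_onAdaptedCone {S : Finset σ} {j : σ} (hj : j ∈ S) (b : σ → K)
    (hbj : b j = 0) (hbN : ∀ i, i ∉ S → b i = 0) (s : CState σ K) (h1 : IsFirstKind p S s)
    (hcone : ¬ PointBlowup.OnAdaptedCone s.exc s.toState (PointBlowup.direction j b)) :
    (step p S j b s).omega < s.omega := by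
  unfold PointBlowup.OnAdaptedCone at hcone
  push Not at hcone
  obtain ⟨g, hg, hgv⟩ := hcone
  change g ∈ PointBlowup.coneGens s.exc s.F at hg
  -- `F ≠ 0`: the cone generators of `0` are `0`, hence invariant
  have hF : s.F ≠ 0 := fun hF => hgv (by
    rw [eq_zero_of_mem_coneGens' s.exc hF hg]
    show PointBlowup.translate _ 0 = 0
    unfold PointBlowup.translate
    exact map_zero _)
  obtain ⟨o, ho⟩ := exists_ordZero_eq' hF
  obtain ⟨-, -, hr, -, -, -, hHoff⟩ := firstKind_bookkeeping' h1 ho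
  set Hv := PointBlowup.bigHVec s.exc s.F with hHv
  set εn := o - Hv.degree with hεn
  have hε : s.epsilon = (εn : ℕ∞) := epsilon_eq_natCast' s ho
  have hhomIn : (initialForm s.F).IsHomogeneous o := by
    have h : (initialForm s.F).IsHomogeneous (ordZero s.F).toNat :=
      homogeneousComponent_isHomogeneous (ordZero s.F).toNat s.F
    have hn : (ordZero s.F).toNat = o := by
      rw [ho]
      exact ENat.toNat_coe o
    rw [hn] at h
    exact h
  by_cases hV : PointBlowup.VNonzero s.exc s.F
  · -- `ω(x) = ε(x) − 1`; the generators are the `H⁻¹ ∂F_{p,Z}/∂U_l`, `l ∉ E`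
    have hg' : ∃ l, l ∉ s.exc ∧ g = (pderiv l (initialForm s.F)).divMonomial Hv := by
      have h := hg
      unfold PointBlowup.coneGens at h
      rw [if_pos hV] at h
      exact h
    obtain ⟨l, hlE, rfl⟩ := hg'
    have hHl : Hv l = 0 := hHoff l hlE
    have hhom : ((pderiv l (initialForm s.F)).divMonomial Hv).IsHomogeneous (εn - 1) := by
      have h := isHomogeneous_divMonomial' (isHomogeneous_pderiv' hhomIn l) Hv
      have heq : o - 1 - Hv.degree = εn - 1 := by omega
      rw [heq] at h
      exact h
    obtain ⟨β₀, hβ₀, hβ₀lt⟩ := exists_degree_lt_of_not_inMax' j b hbj hhom hgv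
    have hΓ : (X l * pderiv l (initialForm s.F)).divMonomial Hv =
        X l * (pderiv l (initialForm s.F)).divMonomial Hv := (X_mul_divMonomial' l hHl _).symm
    have hcore : (step p S j b s).omega ≤ ((εn - 2 : ℕ) : ℕ∞) := by
      by_cases hlj : l = j
      · -- chart variable: `W = W₀`
        refine omega_step_le_cone_core' p hj b hbj hbN s h1 ho l (m := εn - 2) (δ := 0)
          (Nat.zero_le _) (fun h => absurd h Nat.zero_ne_one) ⟨β₀, ?_, by omega⟩
        rw [hΓ, map_mul, dehom_X', if_pos hlj, one_mul]
        exact hβ₀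
      · by_cases hbl : b l = 0
        · -- untranslated variable off `E`: `W = U_l W₀`, a `V`-witness one degree up
          refine omega_step_le_cone_core' p hj b hbj hbN s h1 ho l (m := εn - 2) (δ := 1) le_rfl
            (fun _ => ⟨hlj, hbl, hlE⟩) ⟨Finsupp.single l 1 + β₀, ?_, ?_⟩
          · rw [hΓ, map_mul, dehom_X', if_neg hlj, PointBlowup.translate_X_mul, hbl, C_0, add_zero,
              MvPolynomial.mem_support_iff, coeff_X_mul]
            exact MvPolynomial.mem_support_iff.mp hβ₀
          · rw [map_add, Finsupp.degree_single]
            omega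
        · -- translated variable: `W = (U_l + b_l) W₀` keeps the lowest monomials of `W₀`
          have hne0 : (PointBlowup.translate b
              (dehom j ((pderiv l (initialForm s.F)).divMonomial Hv))).support.Nonempty := ⟨β₀, hβ₀⟩
          obtain ⟨β₁, hβ₁, hβ₁min⟩ :=
            Finset.exists_min_image _ (fun β : σ →₀ ℕ => β.degree) hne0
          refine omega_step_le_cone_core' p hj b hbj hbN s h1 ho l (m := εn - 2) (δ := 0)
            (Nat.zero_le _) (fun h => absurd h Nat.zero_ne_one) ⟨β₁, ?_, ?_⟩
          · rw [hΓ, map_mul, dehom_X', if_neg hlj, PointBlowup.translate_X_mul,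
              MvPolynomial.mem_support_iff, add_mul, coeff_add, coeff_C_mul, coeff_X_mul']
            have hlow : (if l ∈ β₁.support then coeff (β₁ - Finsupp.single l 1)
                (PointBlowup.translate b (dehom j ((pderiv l (initialForm s.F)).divMonomial Hv)))
                else 0) = 0 := by
              split_ifs with hl
              · by_contra hne
                have hle := hβ₁min _ (MvPolynomial.mem_support_iff.mpr hne)
                have hsub : β₁ - Finsupp.single l 1 + Finsupp.single l 1 = β₁ :=
                  tsub_add_cancel_of_le (Finsupp.single_le_iff.mpr
                    (Nat.one_le_iff_ne_zero.mpr (Finsupp.mem_support_iff.mp hl)))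
                have h2 : (β₁ - Finsupp.single l 1).degree + 1 = β₁.degree := by
                  conv_rhs => rw [← hsub]
                  rw [map_add, Finsupp.degree_single]
                omega
              · rfl
            rw [hlow, zero_add]
            exact mul_ne_zero hbl (MvPolynomial.mem_support_iff.mp hβ₁)
          · have := hβ₁min β₀ hβ₀
            omega
    rw [CState.omega_eq_of_vNonzero s hV, hε]
    have h2 : εn - 2 < εn - 1 := by omega
    calc (step p S j b s).omega ≤ ((εn - 2 : ℕ) : ℕ∞) := hcore
      _ < ((εn - 1 : ℕ) : ℕ∞) := by exact_mod_cast h2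
      _ = (εn : ℕ∞) - 1 := by rw [ENat.coe_sub, Nat.cast_one]
  · -- `ω(x) = ε(x)`; the generators are the `H⁻¹ U_l ∂F_{p,Z}/∂U_l`, `l ∈ E`
    have hg' : ∃ l, l ∈ s.exc ∧ g = (X l * pderiv l (initialForm s.F)).divMonomial Hv := by
      have h := hg
      unfold PointBlowup.coneGens at h
      rw [if_neg hV] at h
      exact h
    obtain ⟨l, -, rfl⟩ := hg'
    have hhom : ((X l * pderiv l (initialForm s.F)).divMonomial Hv).IsHomogeneous εn :=
      isHomogeneous_divMonomial' (isHomogeneous_X_mul_pderiv' hhomIn l) Hv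
    obtain ⟨β₀, hβ₀, hβ₀lt⟩ := exists_degree_lt_of_not_inMax' j b hbj hhom hgv
    have hcore := omega_step_le_cone_core' p hj b hbj hbN s h1 ho l (m := εn - 1) (δ := 0)
      (Nat.zero_le _) (fun h => absurd h Nat.zero_ne_one) ⟨β₀, hβ₀, by omega⟩
    rw [CState.omega_eq_of_not_vNonzero s hV, hε]
    calc (step p S j b s).omega ≤ ((εn - 1 : ℕ) : ℕ∞) := hcore
      _ < (εn : ℕ∞) := by exact_mod_cast (by omega : εn - 1 < εn)

omit hp in
/-- **[CP19, Thm. 3.6] "If equality holds in (3.6.4), then `s' ∈ PC(x,𝒴)`" under the blow-up of a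
permissible centre OF THE FIRST KIND, in the model**: if `ω(x') = ω(x)` at the point `b` of the chart
`j ∈ S`, then its direction lies in the cone `Max(x)` (Def. 3.3: `C(x,𝒴)` is cut out by
`IMax(x) ∩ k(x)[{U_j}_{j∈J}]`). [cite: CossartPiltant2019, Thm. 3.6 (p. 35) with Def. 3.3 (p. 33)] -/
theorem onAdaptedCone_of_omegaStalls_of_isFirstKind {S : Finset σ} {j : σ} (hj : j ∈ S) (b : σ → K)
    (hbj : b j = 0) (hbN : ∀ i, i ∉ S → b i = 0) (s : CState σ K) (h1 : IsFirstKind p S s)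
    (hstall : OmegaStalls p S j b s) :
    PointBlowup.OnAdaptedCone s.exc s.toState (PointBlowup.direction j b) := by
  by_contra hcone
  exact absurd hstall (ne_of_lt (omega_step_lt_of_not_onAdaptedCone p hj b hbj hbN s h1 hcone))

end Cone

end CentreBlowup.CState

namespace CentreBlowup

section Predicate

variable {σ : Type*} {K : Type*} [Field K] [Fintype σ] [DecidableEq σ] [DecidableEq K]

/-- [CP19, Thm. 3.6, equality clause] READ AT ONE `C_S`-STEP OF THE FIRST KIND: "If equality holds in
(3.6.4) [`(m(x'), ω(x'), κ(x')) = (m(x), ω(x), κ(x))`], then `s' ∈ PC(x,𝒴)`", where for `𝒴` of the first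
kind "`C(x,𝒴) := Spec(k(x)[{U_j}_{j∈J}]/(IMax(x) ∩ k(x)[{U_j}_{j∈J}]))`" (Def. 3.3) and `PC(x,𝒴) ↪ σ⁻¹(m_S)`:
at a point of the fibre over the origin (`j ∈ S`, `b_j = 0`, `b = 0` off `S`) which is again `p`-fold and
where `ω` stalls, the direction `e_j + Σ_{i≠j} b_i e_i` lies in `Max(x)` (`κ ≥ 2` on both sides since
`i₀ = p`).  Hypotheses of the printed theorem not modelled: well adapted coordinates on both sides,
condition (E).  The test predicate of the census (tables T36b-cc); proved below for every `S, j, b, s`.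
[cite: CossartPiltant2019, Thm. 3.6 (p. 35) with Def. 3.3 (p. 33)] -/
def StallOnConeAtCentre (p : ℕ) (S : Finset σ) (j : σ) (b : σ → K) (s : CState σ K) : Prop :=
  j ∈ S → b j = 0 → (∀ i, i ∉ S → b i = 0) → IsFirstKind p S s →
    IsEquimultiplePoint p S j b s → 0 < s.omega → s.omega ≠ ⊤ → OmegaStalls p S j b s →
    PointBlowup.OnAdaptedCone s.exc s.toState (PointBlowup.direction j b)

variable (p : ℕ) [hp : Fact p.Prime] [CharP K p]

omit hp in
/-- **The equality clause of [CP19, Thm. 3.6] read at one blow-up of a first-kind coordinate centre holds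
in the model, for every `S, j, b, s`** (its hypotheses `IsEquimultiplePoint`, `0 < ω(x) < ⊤` are not
used). [cite: CossartPiltant2019, Thm. 3.6 (p. 35) with Def. 3.3 (p. 33)] -/
theorem CState.stallOnConeAtCentre (S : Finset σ) (j : σ) (b : σ → K) (s : CState σ K) :
    StallOnConeAtCentre p S j b s :=
  fun hj hbj hbN h1 _ _ _ hstall =>
    CState.onAdaptedCone_of_omegaStalls_of_isFirstKind p hj b hbj hbN s h1 hstall

/-- The centre-side `ω`-stall predicate at `S = univ` is the point-side one of `PointBlowupAdaptedOrder`.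
[cite: CossartPiltant2019, Thm. 3.6 (p. 35)] -/
theorem omegaStalls_univ_iff (q : ℕ) (j : σ) (b : σ → K) (s : CState σ K) :
    OmegaStalls q Finset.univ j b s ↔ PointBlowup.OmegaStalls q j b s.exc s.toState := by
  unfold OmegaStalls PointBlowup.OmegaStalls
  rw [omega_step_univ]
  rfl

omit hp in
/-- **The row-wise test predicate `PointBlowup.StallOnConeAt p j b E s` of the point atlas
(`PointBlowupAdaptedOrder.lean`: [CP19, Thm. 3.6] equality clause read at one point blow-up) holds at
every point `b` of the exceptional divisor of the chart `y_j` (`b_j = 0`), for every boundary `E`, at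
every `p`-fold point (`p ≤ ord₀ F`: the point is then a first-kind centre, `isFirstKind_univ`)** (its
hypotheses `IsEquimultiplePoint`, `0 < ω(x) < ⊤` are not used).
[cite: CossartPiltant2019, Thm. 3.6 (p. 35) with Def. 3.1 (p. 31) and Def. 3.3 (p. 33)] -/
theorem CState.stallOnConeAt_point (j : σ) (b : σ → K) (hbj : b j = 0) (E : Finset σ)
    (s : PointBlowup.State σ K) (hord : (p : ℕ∞) ≤ ordZero s.F) :
    PointBlowup.StallOnConeAt p j b E s := by
  intro _ _ _ hstall
  haveI : Nonempty σ := ⟨j⟩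
  let c : CState σ K := ⟨s.F, s.r, E⟩
  have h1 : IsFirstKind p Finset.univ c := isFirstKind_univ p c hord
  by_contra hcone
  have h := CState.omega_step_lt_of_not_onAdaptedCone p (Finset.mem_univ j) b hbj
    (fun i hi => absurd (Finset.mem_univ i) hi) c h1 hcone
  have hstall' : OmegaStalls p Finset.univ j b c := by
    rw [omegaStalls_univ_iff]
    exact hstall
  exact absurd hstall' (ne_of_lt h)

end Predicate

end CentreBlowup

/-! ### 8. Centres of the SECOND kind: the cone `C(x,𝒴) = Max(J̄(F_{p,Z,W},E,W))` of Def. 3.3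

[CP19, Def. 3.3, PDF p. 33]: for `𝒴` of the second kind, "`C(x,𝒴) := Max(J̄(F_{p,Z,W},E,W)) ∩ {U_{B_J}=0}`
… `PC(x,𝒴) ⊆ Proj(G(W)/εG(W)) = Proj k(x)[{U_j}_{j∈J}] = σ⁻¹(x)`", where by the proof of Prop. 3.3
(PDF p. 32) "`J(F_{p,Z,W},E,W) = H_W^{-1} <∂F_{p,Z,W}/∂U_{j'}>` … `J̄(F_{p,Z,W},E,W) = <H⁻¹∂F_{p,Z}/∂U_{j'}
: j' ∈ J' ∖ (J')_E> ⊆ k(x)[{U_j}_{j∈J}]_{ε(y)}`" (`J' = {1,…,n} ∖ J` the variables off the centre,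
`(J')_E` those dividing `E`; `B = ∅` since `i₀ = p`, `G = 0`), and the proof of Thm. 3.6, "Case 3:
`𝒴` is of the second kind" (PDF p. 39): "we deduce that `ord̄ J(F_{p,Z',W'},E_{W'},W') ≤ ω(x)` and
equality holds only if `s' ∈ PC(x,𝒴)` … Suppose that `s' ∉ PC(x,𝒴)` and `ω(x') ≥ ω(x)`. Formula (…)
shows that `ε(x') = ω(x') = ω(x)` … If `i₀(m_{S'}) = p`, we may pick `j' = j_i ∈ J'∖(J')_E` … such
that `ord̄(U^{−ε(y)}Φ_{j'}({U_j}_{j∈J}))_{m̄'} < ω(x)`. By (…), we have `H'⁻¹∂F_{p,Z'}/∂U'_i ≠ 0`.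
This is a contradiction with the assumption `ε(x') = ω(x')`. Thus it can be assumed that
`s' ∈ PC(x,𝒴)`".

Dictionary: at a coordinate centre `C_S` of the second kind in Hironaka–permissible reading
(`IsSecondKindH p S s`, tree `CentreBlowupTransverseH` / `CentreBlowupProp33`: `p ≤ ord_{C_S}F`,
`ε(y) + 1 = ε(x)` and (3.3.1)) the generators of `J̄` are the `H⁻¹ ∂F_{p,Z}/∂U_l`, `l ∉ S`, `l ∉ exc`
(forms of degree `ω(x) = ε(y)` in the `U_S` alone, `initialForm_transverseDegree_le_of_isSecondKindH`);
"`s' ∈ PC(x,𝒴)`" at the point `b` of the chart `j ∈ S` ⟷ `OnSecondKindCone S s (direction j b)`.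
The mechanism of §2–§4 applies verbatim to `U_l ∂F/∂U_l` (`l ∉ S ∪ exc`, `b_l = 0`), the only change
being the bookkeeping: the initial monomials of `U_l ∂F/∂U_l` have `deg_S = ord_{C_S}F` by (3.3.1), and
`ε(x') ≤ ord₀F' − |R|` (`R = (H|_E, ord_{C_S}F − p at j)|_{b=0}`) is read off `H(x') ≥ R` directly. -/

namespace CentreBlowup

section SecondKindCone

variable {σ : Type*} {K : Type*} [Field K] [DecidableEq σ]

/-- "`v ∈ C(x,𝒴)`" for a centre `C_S` OF THE SECOND KIND: `v` leaves every generator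
`H⁻¹ ∂F_{p,Z}/∂U_l` (`l ∉ S`, `l` not a component of `E`) of `J̄(F_{p,Z,W},E,W)` translation invariant
(`U_{B_J} = ∅` since `G = 0`). [cite: CossartPiltant2019, Def. 3.3 (p. 33) with Prop. 3.3 (p. 32)] -/
def OnSecondKindCone (S : Finset σ) (s : CState σ K) (v : σ → K) : Prop :=
  ∀ l, l ∉ S → l ∉ s.exc →
    PointBlowup.InMax ((pderiv l (initialForm s.F)).divMonomial (PointBlowup.bigHVec s.exc s.F)) v

/-- At a point where `V(F_{p,Z},E) ≠ 0` the second-kind generators are among the generators of the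
point cone ideal `V(F_{p,Z},E)`, so `Max(x) ⊆ C(x,𝒴)`. [cite: CossartPiltant2019, Def. 2.17 (p. 24) and Def. 3.3 (p. 33)] -/
theorem onSecondKindCone_of_onAdaptedCone (S : Finset σ) (s : CState σ K) (v : σ → K)
    (hV : PointBlowup.VNonzero s.exc s.F) (h : PointBlowup.OnAdaptedCone s.exc s.toState v) :
    OnSecondKindCone S s v := by
  intro l _ hlE
  apply h
  show _ ∈ PointBlowup.coneGens s.exc s.F
  unfold PointBlowup.coneGens
  rw [if_pos hV]
  exact ⟨l, hlE, rfl⟩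

end SecondKindCone

section SecondKindMain

variable {σ : Type*} {K : Type*} [Field K] [Fintype σ] [DecidableEq σ] [DecidableEq K]
variable (p : ℕ) [hp : Fact p.Prime] [CharP K p]

omit [DecidableEq K] hp [CharP K p] in
/-- The numbers at a second-kind centre (`IsSecondKindH`) with `ord₀ F = o`, in `ℕ`: with `H = H|_exc` and
`k := ord_{C_S} F` one has `q ≤ k ≤ deg_S d`, `H ≤ d`, `|d| ≥ o` for every monomial `y^d` of `F`,
`o = k + 1 + Σ_{u ∉ S} H_u` (Prop. 3.3), `deg_S d = k` for every INITIAL monomial involving a variable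
`U_l`, `l ∉ S ∪ exc` ((3.3.1)), `H = 0` off `exc`, `deg_S H ≤ k` and `ω(x) = ε(y) = k − deg_S H`.
[cite: CossartPiltant2019, Def. 3.1 (p. 31), Prop. 3.3 (p. 32)] -/
private theorem secondKind_bookkeeping' {q : ℕ} {S : Finset σ} {s : CState σ K}
    (h2 : IsSecondKindH q S s) {o : ℕ} (ho : ordZero s.F = o) :
    ∃ k : ℕ, ordAlong S s.F = k ∧ q ≤ k ∧
      (∀ d ∈ s.F.support, k ≤ degIn S d) ∧
      (∀ d ∈ s.F.support, PointBlowup.bigHVec s.exc s.F ≤ d) ∧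
      (∀ d ∈ s.F.support, o ≤ d.degree) ∧
      o = k + 1 + ∑ u ∈ Sᶜ, PointBlowup.bigHVec s.exc s.F u ∧
      (∀ l, l ∉ S → l ∉ s.exc → ∀ d ∈ s.F.support, d.degree = o → d l ≠ 0 → degIn S d = k) ∧
      (∀ i, i ∉ s.exc → PointBlowup.bigHVec s.exc s.F i = 0) ∧
      degIn S (PointBlowup.bigHVec s.exc s.F) ≤ k ∧
      s.omega = ((k - degIn S (PointBlowup.bigHVec s.exc s.F) : ℕ) : ℕ∞) := by
  have hF : s.F ≠ 0 := ne_zero_of_ordZero_eq' ho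
  obtain ⟨⟨-, hqord⟩, -, d₀, hd₀, hdeg₀, -⟩ := id h2
  set Hv := PointBlowup.bigHVec s.exc s.F with hHv
  set k := degIn S d₀ with hkdef
  have hk : ordAlong S s.F = k := hdeg₀.symm
  have hqk : q ≤ k := by
    rw [hk] at hqord
    exact_mod_cast hqord
  have hmin : ∀ d ∈ s.F.support, k ≤ degIn S d := fun d hd => by
    have h : ordAlong S s.F ≤ (degIn S d : ℕ∞) := Finset.inf_le hd
    rw [hk] at h
    exact_mod_cast h
  have hr : ∀ d ∈ s.F.support, Hv ≤ d := bigHVec_le' s.exc s.F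
  obtain ⟨-, hlow⟩ := (ordZero_eq_nat_iff s.F o).mp ho
  have hodeg : ∀ d ∈ s.F.support, o ≤ d.degree := fun d hd => by
    by_contra hlt
    exact (MvPolynomial.mem_support_iff.mp hd) (hlow d (not_le.mp hlt))
  have hHoff : ∀ i, i ∉ s.exc → Hv i = 0 := fun i hi => by rw [hHv, bigHVec_apply', if_neg hi]
  have hHnat : ∀ i ∈ s.exc, PointBlowup.bigH s.F i = ((Hv i : ℕ) : ℕ∞) := fun i hi => by
    rw [bigH_eq_toNat' hF i, hHv, bigHVec_apply', if_pos hi]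
  have hsumSc : ∑ u ∈ Sᶜ, Hv u = ∑ u ∈ s.exc \ S, Hv u := by
    symm
    refine Finset.sum_subset (fun u hu => Finset.mem_compl.mpr (Finset.mem_sdiff.mp hu).2) ?_
    intro u huc hu
    exact hHoff u (fun huE => hu (Finset.mem_sdiff.mpr ⟨huE, Finset.mem_compl.mp huc⟩))
  have hsumE : ∑ u ∈ s.exc \ S, PointBlowup.bigH s.F u = ((∑ u ∈ s.exc \ S, Hv u : ℕ) : ℕ∞) := by
    rw [Nat.cast_sum]
    exact Finset.sum_congr rfl fun u hu => hHnat u (Finset.mem_sdiff.mp hu).1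
  -- `o = k + 1 + Σ_{u ∈ exc∖S} H_u` (first display of the proof of Prop. 3.3)
  have ho' : o = k + 1 + ∑ u ∈ Sᶜ, Hv u := by
    have h := ordZero_eq_of_isSecondKindH h2
    rw [ho, hk, hsumE] at h
    rw [hsumSc]
    exact_mod_cast h
  -- (3.3.1): an initial monomial involving a variable `U_l`, `l ∉ S ∪ exc`, has `deg_S = k`
  have hinitl : ∀ l, l ∉ S → l ∉ s.exc → ∀ d ∈ s.F.support, d.degree = o → d l ≠ 0 →
      degIn S d = k := by
    intro l hlS hlE d hd hdo hdl
    have hdin : d ∈ (initialForm s.F).support := by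
      rw [MvPolynomial.mem_support_iff]
      unfold HauserPerlega2019.initialForm
      rw [coeff_homogeneousComponent, ho, ENat.toNat_coe, if_pos hdo]
      exact MvPolynomial.mem_support_iff.mp hd
    have hT := initialForm_transverseDegree_le_of_isSecondKindH h2 d hdin
    rw [hsumE, ← Nat.cast_one, ← Nat.cast_add] at hT
    have hT' : ∑ u ∈ Sᶜ, d u ≤ 1 + ∑ u ∈ s.exc \ S, Hv u := by exact_mod_cast hT
    have hsub : insert l (s.exc \ S) ⊆ Sᶜ := by
      intro u hu
      rw [Finset.mem_insert] at hu
      rcases hu with rfl | hu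
      · exact Finset.mem_compl.mpr hlS
      · exact Finset.mem_compl.mpr (Finset.mem_sdiff.mp hu).2
    have hlnot : l ∉ s.exc \ S := fun h => hlE (Finset.mem_sdiff.mp h).1
    have hlowd : d l + ∑ u ∈ s.exc \ S, Hv u ≤ ∑ u ∈ Sᶜ, d u :=
      calc d l + ∑ u ∈ s.exc \ S, Hv u ≤ d l + ∑ u ∈ s.exc \ S, d u :=
            Nat.add_le_add_left (Finset.sum_le_sum fun u _ => Finsupp.le_def.mp (hr d hd) u) _
        _ = ∑ u ∈ insert l (s.exc \ S), d u := (Finset.sum_insert hlnot).symm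
        _ ≤ ∑ u ∈ Sᶜ, d u :=
            Finset.sum_le_sum_of_subset_of_nonneg hsub (fun _ _ _ => Nat.zero_le _)
    have h1 := degIn_add_sum_compl S d
    have hdl1 : 1 ≤ d l := Nat.one_le_iff_ne_zero.mpr hdl
    omega
  have hdegInHv : degIn S Hv = ∑ i ∈ S ∩ s.exc, Hv i := by
    unfold degIn
    exact (Finset.sum_subset Finset.inter_subset_left fun i hiS hi => by
      rw [hHoff i (fun hiE => hi (Finset.mem_inter.mpr ⟨hiS, hiE⟩))]).symm
  have hHk : degIn S Hv ≤ k := degIn_le_degIn_of_le S (hr d₀ hd₀)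
  have hω : s.omega = ((k - degIn S Hv : ℕ) : ℕ∞) := by
    rw [omega_eq_epsilonAlong_of_isSecondKindH h2]
    unfold epsilonAlong
    have h3 : ∑ i ∈ S ∩ s.exc, PointBlowup.bigH s.F i = ((∑ i ∈ S ∩ s.exc, Hv i : ℕ) : ℕ∞) := by
      rw [Nat.cast_sum]
      exact Finset.sum_congr rfl fun i hi => hHnat i (Finset.mem_inter.mp hi).2
    rw [hk, h3, hdegInHv, ← ENat.coe_sub]
  exact ⟨k, hk, hqk, hmin, hr, hodeg, ho', hinitl, hHoff, hHk, hω⟩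

omit [Fintype σ] hp [CharP K p] in
/-- A monomial of `F'` comes from some monomial of `F` through the chart map and the translation.
[folklore] -/
private theorem exists_of_mem_support_step' (q : ℕ) (S : Finset σ) (j : σ) (b : σ → K)
    (s : CState σ K) {E : σ →₀ ℕ} (hE : E ∈ (step q S j b s).F.support) :
    ∃ d ∈ s.F.support,
      coeff E (PointBlowup.translate b (monomial (chartExponent q S j d) (coeff d s.F))) ≠ 0 := by
  have h := MvPolynomial.mem_support_iff.mp hE
  change coeff E (deletePthPowers q (pointTransform q S j b s)) ≠ 0 at h
  rw [coeff_deletePthPowers] at h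
  split_ifs at h with hP
  · exact (h rfl).elim
  · rw [pointTransform_eq_sum, coeff_sum] at h
    exact Finset.exists_ne_zero_of_sum_ne_zero h

omit hp [CharP K p] in
/-- `H(x') ≥ R` read directly: `H'_j ≥ ord_{C_S}F − q ≥ k − q` (the `y_j`-exponent of every transformed
monomial is `deg_S d − q`) and `H'_i ≥ H_i` at the untranslated old components `i ≠ j`, `b_i = 0`; hence
`|R| ≤ Σ_{i ∈ E'} H'_i` for `R = (H|_E with k − q at j)|_{b = 0}`. [folklore] -/
private theorem degree_le_sum_bigH_step' (q : ℕ) (S : Finset σ) (j : σ) (b : σ → K) (hbj : b j = 0)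
    (s : CState σ K) {k : ℕ} (hmin : ∀ d ∈ s.F.support, k ≤ degIn S d) :
    (((((PointBlowup.bigHVec s.exc s.F).update j (k - q)).filter fun i => b i = 0).degree : ℕ) :
        ℕ∞) ≤ ∑ i ∈ (step q S j b s).exc, PointBlowup.bigH (step q S j b s).F i := by
  set Hv := PointBlowup.bigHVec s.exc s.F with hHv
  set ρZ : σ →₀ ℕ := (Hv.update j (k - q)).filter (fun i => b i = 0) with hρZ
  have hρZapp : ∀ i, ρZ i = if b i = 0 then (if i = j then k - q else Hv i) else 0 := fun i => by
    rw [hρZ, Finsupp.filter_apply, Finsupp.update_apply]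
  have hsub : ∀ i, ρZ i ≠ 0 → i ∈ (step q S j b s).exc := by
    intro i hi
    show i ∈ newExc j b s
    unfold newExc
    rw [Finset.mem_insert, Finset.mem_filter]
    rw [hρZapp] at hi
    by_cases hbi : b i = 0
    · rw [if_pos hbi] at hi
      by_cases hij : i = j
      · exact Or.inl hij
      · rw [if_neg hij] at hi
        right
        refine ⟨?_, hbi⟩
        by_contra hiE
        exact hi (by rw [hHv, bigHVec_apply', if_neg hiE])
    · rw [if_neg hbi] at hi
      exact absurd rfl hi
  have hterm : ∀ i ∈ (step q S j b s).exc,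
      ((ρZ i : ℕ) : ℕ∞) ≤ PointBlowup.bigH (step q S j b s).F i := by
    intro i _
    rw [hρZapp]
    by_cases hbi : b i = 0
    · rw [if_pos hbi]
      by_cases hij : i = j
      · rw [if_pos hij]
        refine Finset.le_inf fun E hE => ?_
        obtain ⟨d, hd, hne⟩ := exists_of_mem_support_step' q S j b s hE
        have h := PointBlowup.apply_eq_of_coeff_translate_monomial_ne_zero b hbj hne
        rw [chartExponent_apply_self'] at h
        change ((k - q : ℕ) : ℕ∞) ≤ ((E i : ℕ) : ℕ∞)
        rw [hij, h]
        exact_mod_cast Nat.sub_le_sub_right (hmin d hd) q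
      · rw [if_neg hij]
        refine Finset.le_inf fun E hE => ?_
        obtain ⟨d, hd, hne⟩ := exists_of_mem_support_step' q S j b s hE
        have h := PointBlowup.apply_eq_of_coeff_translate_monomial_ne_zero b hbi hne
        rw [chartExponent_apply_of_ne' q S hij] at h
        change ((Hv i : ℕ) : ℕ∞) ≤ ((E i : ℕ) : ℕ∞)
        rw [h]
        exact_mod_cast Finsupp.le_def.mp (bigHVec_le' s.exc s.F d hd) i
    · rw [if_neg hbi, Nat.cast_zero]
      exact zero_le
  calc (((ρZ.degree : ℕ)) : ℕ∞) = ∑ i ∈ ρZ.support, ((ρZ i : ℕ) : ℕ∞) := by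
        rw [Finsupp.degree_apply, Nat.cast_sum]
    _ ≤ ∑ i ∈ (step q S j b s).exc, ((ρZ i : ℕ) : ℕ∞) :=
        Finset.sum_le_sum_of_subset_of_nonneg
          (fun i hi => hsub i (Finsupp.mem_support_iff.mp hi)) (fun _ _ _ => zero_le)
    _ ≤ ∑ i ∈ (step q S j b s).exc, PointBlowup.bigH (step q S j b s).F i := Finset.sum_le_sum hterm

omit [Fintype σ] [DecidableEq K] hp [CharP K p] in
/-- Re-indexing a monomial sum weighted by `d_l c_d` over the monomials of `U_l ∂F/∂U_l`. [folklore] -/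
private theorem sum_filter_X_mul_pderiv' (F : MvPolynomial σ K) (l : σ) (P : (σ →₀ ℕ) → Prop)
    [DecidablePred P] (e : (σ →₀ ℕ) → (σ →₀ ℕ)) :
    ∑ d ∈ (X l * pderiv l F).support.filter P, monomial (e d) (1 * coeff d (X l * pderiv l F)) =
      ∑ d ∈ F.support.filter P, monomial (e d) (((d l : ℕ) : K) * coeff d F) := by
  have hco : ∀ d, coeff d (X l * pderiv l F) = ((d l : ℕ) : K) * coeff d F :=
    fun d => PointBlowup.coeff_X_mul_pderiv l F d
  have hsub : (X l * pderiv l F).support.filter P ⊆ F.support.filter P := by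
    intro d hd
    rw [Finset.mem_filter] at hd ⊢
    refine ⟨MvPolynomial.mem_support_iff.mpr ?_, hd.2⟩
    have h := MvPolynomial.mem_support_iff.mp hd.1
    rw [hco] at h
    exact right_ne_zero_of_mul h
  rw [Finset.sum_congr rfl fun d _ => by rw [one_mul, hco]]
  refine Finset.sum_subset hsub fun d hd hnot => ?_
  have h0 : ((d l : ℕ) : K) * coeff d F = 0 := by
    by_contra hne
    apply hnot
    rw [Finset.mem_filter] at hd ⊢
    refine ⟨MvPolynomial.mem_support_iff.mpr ?_, hd.2⟩
    rw [hco]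
    exact hne
  rw [h0, monomial_zero]

omit hp in
/-- **The estimate off the second-kind cone.**  At a second-kind centre (`IsSecondKindH`) with
`ord₀ F = o`, let `l ∉ S`, `l ∉ E` and suppose the dehomogenised translate
`W = translate_b((H⁻¹U_l ∂F_{p,Z}/∂U_l)|_{U_j = 1})` has a monomial of degree `≤ m + 1`.  Then
`ω(x') ≤ m` (the low monomial of `U_l ∂G/∂U_l = T(U_l ∂F/∂U_l)` is a `V`-witness of `F'`, `U_l` not being
a component of `E'`). [cite: CossartPiltant2019, Thm. 3.6 (p. 35), proof Case 3 (p. 39)] -/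
private theorem omega_step_le_cone_core₂' {S : Finset σ} {j : σ} (hj : j ∈ S) (b : σ → K)
    (hbj : b j = 0) (hbN : ∀ i, i ∉ S → b i = 0) (s : CState σ K) (h2 : IsSecondKindH p S s) {o : ℕ}
    (ho : ordZero s.F = o) {l : σ} (hlS : l ∉ S) (hlE : l ∉ s.exc) {m : ℕ}
    (hex : ∃ β ∈ (PointBlowup.translate b (dehom j
        ((X l * pderiv l (initialForm s.F)).divMonomial (PointBlowup.bigHVec s.exc s.F)))).support,
        β.degree ≤ m + 1) :
    (step p S j b s).omega ≤ (m : ℕ∞) := by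
  obtain ⟨k, -, hpk, hdegIn, hr, hdeg, -, hinitl, -, -, -⟩ := secondKind_bookkeeping' h2 ho
  have hlj : l ≠ j := fun h => hlS (h ▸ hj)
  have hbl : b l = 0 := hbN l hlS
  set Hv := PointBlowup.bigHVec s.exc s.F with hHv
  set Fl : MvPolynomial σ K := X l * pderiv l s.F with hFl
  have hco : ∀ d, coeff d Fl = ((d l : ℕ) : K) * coeff d s.F :=
    fun d => PointBlowup.coeff_X_mul_pderiv l s.F d
  have hFlsupp : ∀ d ∈ Fl.support, d ∈ s.F.support ∧ d l ≠ 0 := fun d hd => by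
    have h := MvPolynomial.mem_support_iff.mp hd
    rw [hco] at h
    refine ⟨MvPolynomial.mem_support_iff.mpr (right_ne_zero_of_mul h), fun h0 => ?_⟩
    apply left_ne_zero_of_mul h
    rw [h0, Nat.cast_zero]
  have hdeg₂ : ∀ d ∈ Fl.support, o ≤ d.degree := fun d hd => hdeg d (hFlsupp d hd).1
  have hdegIn₂ : ∀ d ∈ Fl.support, k ≤ degIn S d := fun d hd => hdegIn d (hFlsupp d hd).1
  have hinit₂ : ∀ d ∈ Fl.support, d.degree = o → degIn S d = k := fun d hd hdo =>
    hinitl l hlS hlE d (hFlsupp d hd).1 hdo (hFlsupp d hd).2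
  have hr₂ : ∀ d ∈ Fl.support, Hv ≤ d := fun d hd => hr d (hFlsupp d hd).1
  -- the record `R = ρ₀|_{b=0}`, `ρ₀ = (H|_E with k − p at j)`, and `ε(x') ≤ ord₀ F' − |R|`
  set ρ₀ : σ →₀ ℕ := Hv.update j (k - p) with hρ₀
  set R : ℕ := (ρ₀.filter fun i => b i = 0).degree with hR
  have hε : (step p S j b s).epsilon ≤ ordZero (step p S j b s).F - (R : ℕ∞) := by
    rw [CState.epsilon_eq]
    exact tsub_le_tsub_left (degree_le_sum_bigH_step' p S j b hbj s hdegIn) _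
  have hρ₀j : ρ₀ j = k - p := by rw [hρ₀, Finsupp.update_apply, if_pos rfl]
  have hρ₀i : ∀ i, i ≠ j → ρ₀ i = Hv i := fun i hi => by rw [hρ₀, Finsupp.update_apply, if_neg hi]
  -- the generator, dehomogenised: `Θ = Σ_{d initial, d_l ≠ 0} d_l c_d y^{(d − H) ∖ j}`
  set T : Finset (σ →₀ ℕ) := Fl.support.filter (fun d => d.degree = o) with hT
  have hmemT : ∀ d ∈ T, d ∈ Fl.support ∧ d.degree = o := fun d hd => Finset.mem_filter.mp hd
  set Θ : MvPolynomial σ K := dehom j ((X l * pderiv l (initialForm s.F)).divMonomial Hv) with hΘ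
  have hΓ : (X l * pderiv l (initialForm s.F)).divMonomial Hv =
      ∑ d ∈ T, monomial (d - Hv) (1 * coeff d Fl) := by
    rw [X_mul_pderiv_initialForm_divMonomial_eq' ho Hv hr l, hT, hFl,
      sum_filter_X_mul_pderiv' s.F l (fun d => d.degree = o) (fun d => d - Hv)]
  have hΘsum : Θ = ∑ d ∈ T, monomial ((d - Hv).erase j) (1 * coeff d Fl) := by
    rw [hΘ, hΓ, map_sum]
    exact Finset.sum_congr rfl fun d _ => dehom_monomial' j _ _
  have hΘj : ∀ e ∈ Θ.support, e j = 0 := by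
    intro e he
    rw [hΘsum] at he
    obtain ⟨d, -, -, rfl⟩ := PointBlowup.exists_of_mem_support_sum_monomial T _ _ he
    exact Finsupp.erase_same
  have hfac : ∑ d ∈ T, monomial (chartExponent p S j d) (1 * coeff d Fl) = monomial ρ₀ 1 * Θ := by
    rw [hΘsum, Finset.mul_sum]
    refine Finset.sum_congr rfl fun d hd => ?_
    obtain ⟨hdF, hdo⟩ := hmemT d hd
    have hexp : chartExponent p S j d = ρ₀ + (d - Hv).erase j := by
      ext i
      rw [Finsupp.add_apply]
      by_cases hij : i = j
      · rw [hij, chartExponent_apply_self', hinit₂ d hdF hdo, hρ₀j, Finsupp.erase_same, add_zero]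
      · rw [chartExponent_apply_of_ne' p S hij, hρ₀i i hij, Finsupp.erase_ne hij, Finsupp.tsub_apply,
          add_tsub_cancel_of_le (Finsupp.le_def.mp (hr₂ d hdF) i)]
    rw [monomial_mul, one_mul, one_mul, hexp]
  -- a monomial of least degree of `translate b Θ`
  obtain ⟨β₁, hβ₁, hβ₁deg⟩ := hex
  have hne : (PointBlowup.translate b Θ).support.Nonempty := ⟨β₁, hβ₁⟩
  obtain ⟨β, hβ, hβmin⟩ := Finset.exists_min_image _ (fun β : σ →₀ ℕ => β.degree) hne
  have hβdeg : β.degree ≤ m + 1 := le_trans (hβmin β₁ hβ₁) hβ₁deg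
  -- the low monomial `ν = R + β` of `T(U_l ∂F/∂U_l) = U_l ∂G/∂U_l`
  have hν := coeff_translate_ne_zero_of_factor' p S hj b hbj hbN Fl hpk hdeg₂ hdegIn₂ hinit₂
    (fun _ => (1 : K)) ρ₀ hρ₀j Θ hΘj hfac hβ hβmin
  set ν : σ →₀ ℕ := (ρ₀.filter fun i => b i = 0) + β with hνdef
  have hνdeg : ν.degree ≤ R + m + 1 := by
    rw [hνdef, map_add, ← hR]
    omega
  have hsumF : ∑ d ∈ Fl.support, monomial (chartExponent p S j d) ((fun _ : σ →₀ ℕ => (1 : K)) d *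
      coeff d Fl) = ∑ d ∈ s.F.support, monomial (chartExponent p S j d) (((d l : ℕ) : K) * coeff d s.F) := by
    have h := sum_filter_X_mul_pderiv' s.F l (fun _ => True) (chartExponent p S j)
    rw [Finset.filter_true, Finset.filter_true] at h
    exact (Finset.sum_congr rfl fun d _ => rfl).trans h
  rw [hsumF, ← transport_log_ne' p S hlj b s.F, hbl, C_0, add_zero, PointBlowup.coeff_X_mul_pderiv] at hν
  have hc : coeff ν (pointTransform p S j b s) ≠ 0 := right_ne_zero_of_mul hν
  have hνl : ¬ p ∣ ν l := by
    rw [← CharP.cast_eq_zero_iff K p]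
    exact left_ne_zero_of_mul hν
  have hlE' : l ∉ (step p S j b s).exc := by
    show l ∉ newExc j b s
    unfold newExc
    rw [Finset.mem_insert, Finset.mem_filter, not_or]
    exact ⟨hlj, fun h => hlE h.1⟩
  exact omega_le_of_low_witness' p _ _ rfl R hε hc hlE' hνl hνdeg

omit hp in
/-- **[CP19, Thm. 3.6, proof Case 3 (p. 39)] `s' ∉ PC(x,𝒴) ⟹ ω(x') < ω(x)` under the blow-up of a
permissible centre OF THE SECOND KIND, in the model**: at every point `b` of the fibre over `x` in every
chart `j ∈ S` whose direction `e_j + Σ b_i e_i` leaves some generator `H⁻¹∂F_{p,Z}/∂U_l` (`l ∉ S`,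
`l ∉ E`) of `J̄(F_{p,Z,W},E,W)` non-invariant, `ω` drops.  No equimultiplicity or `ω(x) > 0` is needed.
[cite: CossartPiltant2019, Thm. 3.6 (p. 35), Def. 3.3 (p. 33), Prop. 3.3 (p. 32), proof Case 3 (p. 39)] -/
theorem CState.omega_step_lt_of_not_onSecondKindCone {S : Finset σ} {j : σ} (hj : j ∈ S) (b : σ → K)
    (hbj : b j = 0) (hbN : ∀ i, i ∉ S → b i = 0) (s : CState σ K) (h2 : IsSecondKindH p S s)
    (hcone : ¬ OnSecondKindCone S s (PointBlowup.direction j b)) :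
    (step p S j b s).omega < s.omega := by
  unfold OnSecondKindCone at hcone
  push Not at hcone
  obtain ⟨l, hlS, hlE, hgv⟩ := hcone
  have hlj : l ≠ j := fun h => hlS (h ▸ hj)
  have hbl : b l = 0 := hbN l hlS
  -- `F ≠ 0`: the generators attached to `0` vanish, hence are invariant
  have hF : s.F ≠ 0 := by
    intro hF
    apply hgv
    have h0 : initialForm s.F = 0 := by
      rw [hF]
      unfold HauserPerlega2019.initialForm
      exact map_zero _
    rw [h0, map_zero, zero_divMonomial]
    show PointBlowup.translate _ 0 = 0
    unfold PointBlowup.translate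
    exact map_zero _
  obtain ⟨o, ho⟩ := exists_ordZero_eq' hF
  obtain ⟨k, -, -, -, -, -, ho', -, hHoff, -, hω⟩ := secondKind_bookkeeping' h2 ho
  set Hv := PointBlowup.bigHVec s.exc s.F with hHv
  set ωn : ℕ := k - degIn S Hv with hωn
  have hhomIn : (initialForm s.F).IsHomogeneous o := by
    have h : (initialForm s.F).IsHomogeneous (ordZero s.F).toNat :=
      homogeneousComponent_isHomogeneous (ordZero s.F).toNat s.F
    have hn : (ordZero s.F).toNat = o := by
      rw [ho]
      exact ENat.toNat_coe o
    rw [hn] at h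
    exact h
  have hHl : Hv l = 0 := hHoff l hlE
  have hdegHv := degIn_add_sum_compl S Hv
  -- the generator `H⁻¹∂F_{p,Z}/∂U_l` is a form of degree `ω(x)`
  have hhom : ((pderiv l (initialForm s.F)).divMonomial Hv).IsHomogeneous ωn := by
    have h := isHomogeneous_divMonomial' (isHomogeneous_pderiv' hhomIn l) Hv
    have heq : o - 1 - Hv.degree = ωn := by
      rw [hωn]
      omega
    rw [heq] at h
    exact h
  obtain ⟨β₀, hβ₀, hβ₀lt⟩ := exists_degree_lt_of_not_inMax' j b hbj hhom hgv
  have hΓ : (X l * pderiv l (initialForm s.F)).divMonomial Hv =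
      X l * (pderiv l (initialForm s.F)).divMonomial Hv := (X_mul_divMonomial' l hHl _).symm
  -- `W = U_l W₀` (`b_l = 0`): a witness one degree up, read as a `V`-witness (`l ∉ E'`)
  have hcore : (step p S j b s).omega ≤ ((ωn - 1 : ℕ) : ℕ∞) := by
    refine omega_step_le_cone_core₂' p hj b hbj hbN s h2 ho hlS hlE (m := ωn - 1)
      ⟨Finsupp.single l 1 + β₀, ?_, ?_⟩
    · rw [hΓ, map_mul, dehom_X', if_neg hlj, PointBlowup.translate_X_mul, hbl, C_0, add_zero,
        MvPolynomial.mem_support_iff, coeff_X_mul]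
      exact MvPolynomial.mem_support_iff.mp hβ₀
    · rw [map_add, Finsupp.degree_single]
      omega
  rw [hω]
  calc (step p S j b s).omega ≤ ((ωn - 1 : ℕ) : ℕ∞) := hcore
    _ < (ωn : ℕ∞) := by exact_mod_cast (by omega : ωn - 1 < ωn)

omit hp in
/-- **[CP19, Thm. 3.6] "If equality holds in (3.6.4), then `s' ∈ PC(x,𝒴)`" under the blow-up of a
permissible centre OF THE SECOND KIND, in the model**: if `ω(x') = ω(x)` at the point `b` of the chart
`j ∈ S`, then its direction lies in the cone `C(x,𝒴) = Max(J̄(F_{p,Z,W},E,W))` of Def. 3.3.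
[cite: CossartPiltant2019, Thm. 3.6 (p. 35) with Def. 3.3 (p. 33) and Prop. 3.3 (p. 32)] -/
theorem CState.onSecondKindCone_of_omegaStalls_of_isSecondKindH {S : Finset σ} {j : σ} (hj : j ∈ S)
    (b : σ → K) (hbj : b j = 0) (hbN : ∀ i, i ∉ S → b i = 0) (s : CState σ K)
    (h2 : IsSecondKindH p S s) (hstall : OmegaStalls p S j b s) :
    OnSecondKindCone S s (PointBlowup.direction j b) := by
  by_contra hcone
  exact absurd hstall (ne_of_lt (CState.omega_step_lt_of_not_onSecondKindCone p hj b hbj hbN s h2 hcone))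

omit hp in
/-- The same at a centre of the second kind in the cell's undivided reading `IsSecondKind` (condition (ii)
of Def. 3.1 on `F` itself), which implies the `H`-divided one. [cite: CossartPiltant2019, Thm. 3.6 (p. 35) with Def. 3.1 (p. 31) and Def. 3.3 (p. 33)] -/
theorem CState.onSecondKindCone_of_omegaStalls_of_isSecondKind {S : Finset σ} {j : σ} (hj : j ∈ S)
    (b : σ → K) (hbj : b j = 0) (hbN : ∀ i, i ∉ S → b i = 0) (s : CState σ K)
    (h2 : IsSecondKind p S s) (hstall : OmegaStalls p S j b s) :
    OnSecondKindCone S s (PointBlowup.direction j b) :=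
  CState.onSecondKindCone_of_omegaStalls_of_isSecondKindH p hj b hbj hbN s
    (isSecondKindH_of_isSecondKind h2) hstall

omit hp in
/-- **At a permissible coordinate centre of either kind, a stall of `ω` puts the direction of the point on
the cone of Def. 3.3 OF THAT KIND** (`Max(x)` for the first kind, `Max(J̄)` for the second).
[cite: CossartPiltant2019, Thm. 3.6 (p. 35) with Def. 3.1 (p. 31) and Def. 3.3 (p. 33)] -/
theorem CState.onCone_of_omegaStalls_of_isPermissibleCentre {S : Finset σ} {j : σ} (hj : j ∈ S)
    (b : σ → K) (hbj : b j = 0) (hbN : ∀ i, i ∉ S → b i = 0) (s : CState σ K)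
    (hperm : IsPermissibleCentre p S s) (hstall : OmegaStalls p S j b s) :
    (IsFirstKind p S s ∧ PointBlowup.OnAdaptedCone s.exc s.toState (PointBlowup.direction j b)) ∨
      (IsSecondKind p S s ∧ OnSecondKindCone S s (PointBlowup.direction j b)) := by
  rcases hperm with h1 | h2
  · exact Or.inl ⟨h1, CState.onAdaptedCone_of_omegaStalls_of_isFirstKind p hj b hbj hbN s h1 hstall⟩
  · exact Or.inr ⟨h2, CState.onSecondKindCone_of_omegaStalls_of_isSecondKind p hj b hbj hbN s h2 hstall⟩

end SecondKindMain

section SecondKindPredicate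

variable {σ : Type*} {K : Type*} [Field K] [Fintype σ] [DecidableEq σ] [DecidableEq K]

/-- [CP19, Thm. 3.6, equality clause] READ AT ONE `C_S`-STEP OF THE SECOND KIND: "If equality holds in
(3.6.4), then `s' ∈ PC(x,𝒴)`", where for `𝒴` of the second kind "`C(x,𝒴) := Max(J̄(F_{p,Z,W},E,W)) ∩
{U_{B_J}=0}`" (Def. 3.3; `B = ∅` since `i₀ = p`): at a point of the fibre over the origin (`j ∈ S`,
`b_j = 0`, `b = 0` off `S`) which is again `p`-fold and where `ω` stalls, the direction
`e_j + Σ_{i≠j} b_i e_i` leaves every `H⁻¹∂F_{p,Z}/∂U_l` (`l ∉ S ∪ E`) invariant.  The centre is of the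
second kind in the Hironaka-permissible, `H`-divided reading `IsSecondKindH` (implied by the atlas's
`IsSecondKind`).  Hypotheses of the printed theorem not modelled: well adapted / well prepared
coordinates, condition (E).  The test predicate for the census of stalls at non-first-kind centres;
proved below for every `S, j, b, s`. [cite: CossartPiltant2019, Thm. 3.6 (p. 35) with Def. 3.3 (p. 33)] -/
def StallOnSecondKindConeAtCentre (p : ℕ) (S : Finset σ) (j : σ) (b : σ → K) (s : CState σ K) :
    Prop :=
  j ∈ S → b j = 0 → (∀ i, i ∉ S → b i = 0) → IsSecondKindH p S s →
    IsEquimultiplePoint p S j b s → 0 < s.omega → s.omega ≠ ⊤ → OmegaStalls p S j b s →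
    OnSecondKindCone S s (PointBlowup.direction j b)

variable (p : ℕ) [hp : Fact p.Prime] [CharP K p]

omit hp in
/-- **The equality clause of [CP19, Thm. 3.6] read at one blow-up of a second-kind coordinate centre
holds in the model, for every `S, j, b, s`** (its hypotheses `IsEquimultiplePoint`, `0 < ω(x) < ⊤` are
not used). [cite: CossartPiltant2019, Thm. 3.6 (p. 35) with Def. 3.3 (p. 33)] -/
theorem CState.stallOnSecondKindConeAtCentre (S : Finset σ) (j : σ) (b : σ → K) (s : CState σ K) :
    StallOnSecondKindConeAtCentre p S j b s :=
  fun hj hbj hbN h2 _ _ _ hstall =>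
    CState.onSecondKindCone_of_omegaStalls_of_isSecondKindH p hj b hbj hbN s h2 hstall

end SecondKindPredicate

end CentreBlowup

end Literature.AlgebraicGeometry.Resolution

end
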